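import Mathlib
import HarnessLib
import Summits.PneNP.PneNP.Theses.OverlapGapAlgebra
import Summits.PneNP.PneNP.Theorems.OverlapGapAlgebraPositiveSatProbability
import Literature.Computability.Complexity.ConstantDepth
import Literature.Computability.Complexity.ACFourierTails
import Literature.Computability.Complexity.RandomKSatLowDegreeHardness
import Summits.PneNP.PneNP.Theorems.OverlapGapAlgebraSearchHardWindowTruncationSurrogate
import Summits.PneNP.PneNP.Theorems.OverlapGapAlgebraSearchHardWindowACTailBound
import Summits.PneNP.PneNP.Theorems.OverlapGapAlgebraSearchHardWindowRungAssembly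
import Literature.Computability.Complexity.DecisionTree
import Literature.Probability.Moments.HoeffdingDecomposition
import Summits.PneNP.PneNP.Theorems.OverlapGapAlgebraNoStableSectionDefs
import Literature.Computability.Complexity.RandomKSatEnsembleOGP
import Summits.PneNP.PneNP.Theorems.OverlapGapAlgebraSearchHardWindowGrandCorrelation
import Summits.PneNP.PneNP.Theorems.OverlapGapAlgebraSearchHardWindowResampleKernelBasic
import Summits.PneNP.PneNP.Theorems.OverlapGapAlgebraSearchHardWindowResamplePositivity
import Summits.PneNP.PneNP.Theorems.OverlapGapAlgebraSearchHardWindowResampleStability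
import Summits.PneNP.PneNP.Theorems.OverlapGapAlgebraSearchHardWindowMoat
import Summits.PneNP.PneNP.Theorems.OverlapGapAlgebraSearchHardWindowWeakClassRung
import Summits.PneNP.PneNP.Theorems.OverlapGapAlgebraSearchHardWindowChainMassBasic
import Summits.PneNP.PneNP.Theorems.OverlapGapAlgebraSearchHardWindowInstability
import Summits.PneNP.PneNP.Theorems.OverlapGapAlgebraSearchHardWindowMoatTransfer
import Summits.PneNP.PneNP.Theorems.OverlapGapAlgebraSearchHardWindowHsAsymptotics
import Summits.PneNP.PneNP.Theorems.OverlapGapAlgebraSearchHardWindowHsAssembly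
import Summits.PneNP.PneNP.Theorems.OverlapGapAlgebraSearchHardWindowChaosTupleBound
import Summits.PneNP.PneNP.Theorems.OverlapGapAlgebraSearchHardWindowChaosAssembly
import Summits.PneNP.PneNP.Theorems.OverlapGapAlgebraSearchHardWindowKernelSemigroup
import Summits.PneNP.PneNP.Theorems.OverlapGapAlgebraSearchHardWindowKernelPowPaths
import Summits.PneNP.PneNP.Theorems.OverlapGapAlgebraSearchHardWindowChainTwoBlock
import Summits.PneNP.PneNP.Theorems.OverlapGapAlgebraSearchHardWindowChainMassUnion
import Summits.PneNP.PneNP.Theorems.OverlapGapAlgebraSearchHardWindowSatProbBound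
import Summits.PneNP.PneNP.Theorems.OverlapGapAlgebraSearchHardWindowLowEntropyCount
import Summits.PneNP.PneNP.Theorems.OverlapGapAlgebraSearchHardWindowChainMassTotal
import Summits.PneNP.PneNP.Theorems.OverlapGapAlgebraSearchHardWindowChaosAsymptotics
import Summits.PneNP.PneNP.Theorems.OverlapGapAlgebraSearchHardWindowObstructionsOfOGP
import Summits.PneNP.PneNP.Theorems.OverlapGapAlgebraSearchHardWindowWeakRungsUnconditional
import Summits.PneNP.PneNP.Theorems.OverlapGapAlgebraSearchHardWindowMultiTimeMarginal
import Summits.PneNP.PneNP.Theorems.OverlapGapAlgebraSearchHardWindowSlotFactorization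
import Summits.PneNP.PneNP.Theorems.OverlapGapAlgebraSearchHardWindowBlockExpansion
import Summits.PneNP.PneNP.Theorems.OverlapGapAlgebraSearchHardWindowSlotBound
import Summits.PneNP.PneNP.Theorems.OverlapGapAlgebraSearchHardWindowBandEnergy
import Summits.PneNP.PneNP.Theorems.OverlapGapAlgebraSearchHardWindowBandCount
import Summits.PneNP.PneNP.Theorems.OverlapGapAlgebraSearchHardWindowOgpAsymptotics

/-!
# Skeleton — crux `stmt-PneNP-2460` (`SearchHardWindow`), line `Sketch` / Line A (approx-degree ladder)

Lead prover `prover-line-stmt-PneNP-2460-0`, 2026-08-16 (v4). Composition (card `approx-degree-ladder`,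
ideator 1, `Cruxes/SearchHardWindow/IdeaSketch_r1_k1.lean`):

  `stub_strongLowDegreeHardness` (OPEN — NAMED FACT `HuangSellke2025KSat`: Huang–Sellke 2025,
  arXiv:2501.06427 Cor. 3.21, deterministic saturated special case, κ = 5; Literature p102648)
  ∧ `stub_polyTimeLowDegreeSimulable` (OPEN — the KERNEL, conjecture-grade, P≠NP-strength)
  ∧ `stub_positiveSatProbability` (CLOSED: tree theorem `positiveSatProbability_proof`)
  ⟹ `stub_lineAComposition` (LANDED p111218, `Theorems/OverlapGapAlgebraSearchHardWindowComposition.lean`) ⟹ `SearchHardWindow_of`.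

Rungs (first unconditional-modulo-citation instances of the crux's hardness predicate, all LANDED
or landing and conditional on the named fact ONLY): `stub_truncationSurrogate` (p103419) ∧
`stub_acTailBound` (p103257) ⟹ `stub_rungAssembly` (p109767: general class rung `shw_classRung` +
AC⁰ instance) ⟹ `stub_acZeroRung` / `stub_acZeroRungPow` (poly-size AC⁰ fails on
`F_k(2^j, ⌊α_k 2^j⌋)`), `stub_decisionTreeRung` (depth-`o(n)` decision trees fail) — LANDED p110869.

Sorries left in this file (v4): exactly the named fact and the kernel.

v5 (continuation lead `prover-line-stmt-PneNP-2460-c1-0`, 2026-08-16): the named fact is no longer a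
leaf — section `HS25` splits it, following Huang–Sellke's own proof of Cor. 3.21, into ONE first-moment
named fact (`stub_obstructions` = HS25 Lemmas 3.22–3.23 on the `ε`-resampling chain) and provable
stubs (grand correlation, resampling-kernel positivity/stochasticity, `L²`-stability of low-degree
functions, the moat/ladder, the assembly); and `stub_weakClassRung` re-derives the class rung in the
weak form from `NoStableSection` alone (no named fact). Open sorries of v5: `stub_obstructions`
(fact), `stub_grandCorrelation`, `stub_resampleKernelBasic`, `stub_resamplePositivity`,
`stub_resampleStability`, `stub_moat`, `stub_hsAssembly`, `stub_weakClassRung`, and the kernel.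

v11 (end of continuation cycle 1, 2026-08-16 19:0xZ): EVERY provable stub has LANDED (25 proposals); the
chaos half of the obstructions fact (HS25 L3.23) is a theorem (`chaos_of`), so the sorries of this file are
exactly TWO: `stub_ensembleOGP` (named fact HS25 L3.22, Literature `HuangSellke2025KSatEnsembleOGP`) and the
kernel. Headline: `huangSellke2025KSat_of_ensembleOGP`; weak AC⁰/decision-tree rungs are UNCONDITIONAL
(`stub_weakRungsUnconditional`, p120026).
v12 (continuation lead c2 `prover-line-stmt-PneNP-2460-c2-0`, 2026-08-16): `stub_ensembleOGP` is no
longer a leaf — section `EnsembleOGP` derives it (literal-level first moment) from EIGHT new stubs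
`stub_multiTimeMarginal` (M), `stub_slotFactorization` (F), `stub_blockExpansion` (R), `stub_slotBound` (G),
`stub_bandEnergy` (E), `stub_bandCount` (C), `stub_ogpCore` (O), `stub_ogpAsymptotics` (A), with the
composition `ogp_tupleBound` and the assembly `ensembleOGP_of_stubs` proved. Sorries of v12: these eight
and the kernel.
v13 (lead c2, end of wave 1): ALL EIGHT LANDED (M p123661, F p123232, R p123569, G p124145, E p123267,
C p123268, O p124260, A p123592); `stub_ensembleOGP` — Huang–Sellke 2025 Lemma 3.22 — is a THEOREM. The only
sorry of this file is the kernel `stub_polyTimeLowDegreeSimulable`.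
v14 (lead c2): cone LANDED — `Theorems/OverlapGapAlgebraSearchHardWindowEnsembleOGPHolds.lean` (p124554):
`huangSellke2025KSatEnsembleOGP_holds`, `huangSellke2025KSatObstructions_holds`, `huangSellke2025KSat_holds`
(three named facts discharged), `acZeroRung_holds`, `decisionTreeRung_holds` — HS25 §3.3 is unconditional in the tree.
v15 (continuation lead c3 `prover-line-stmt-PneNP-2460-c3-0`, 2026-08-16): skeleton UNCHANGED — the only
sorry is the kernel `stub_polyTimeLowDegreeSimulable`, which is not a lemma of the line but the crux's own
residual core: for all large `k` it is EQUIVALENT to the hardness conjunct `H(k, α_k)` of `SearchHardWindow`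
(⟸: `kernelHypothesis_false_of_hardness`, Theorems/SearchHardWindow/Negative/FalseWithoutPolyTime.lean;
⟹: `stub_lineAComposition` with the proved `huangSellke2025KSat_holds` and `positiveSatProbability_proof`),
and `H → SearchHardWindow → PneNP` is in the tree (`searchHardWindow_implies_pneNP`). The unconditional
reduction certificate is `Theorems/OverlapGapAlgebraSearchHardWindowKernelCore.lean` (lead c3). Outcome of
the line: closed modulo the crux itself ⇒ `promote-stub`.
Vocabulary: `Literature/Computability/Complexity/RandomKSatLowDegreeHardness.lean` (coordinate degree
`IsCoordDegreeLE`, bit decoding `litArrayOfBits` / `bitsOfLitArray` / `litArrayEquiv`, the named fact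
`HuangSellke2025KSat`; p102648 + p104380).
-/

-- `Summit.PneNP.PneNP.…` is the tree's mandated namespace (summit = sub-problem name).
set_option linter.dupNamespace false

noncomputable section

namespace Summit.PneNP.PneNP.Cruxes.SearchHardWindow.LineA

open Finset Filter Asymptotics
open Literature.Computability.Complexity
open Literature.Computability.Complexity.LowDegree
open Literature.Probability.RandomGraphs.LowDegree (sgn walsh)
open Summit.PneNP.PneNP.Theses.OverlapGapAlgebra
open Summit.PneNP.PneNP.Cruxes.NoStableSection.DartGame (seqOf seqOf_apply_lt)
open Summit.PneNP.PneNP.Theorems (cmb_kernel_nonneg cmb_ite_congr cas_eventually_lt cas_eps_bounds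
  cas_mono_prefix cas_mass_false bct_overlapCondEnt_congr)
open scoped Classical

/-! ## Vocabulary
`IsCoordDegreeLE`, `litArrayOfBits`, `HuangSellke2025KSat` are the tree's
(`Literature/Computability/Complexity/RandomKSatLowDegreeHardness.lean`, p102648, accepted). -/

/-! ## Discharging the named fact `HuangSellke2025KSat` (Huang–Sellke 2025, §3.3) — sub-skeleton v5

Continuation lead `prover-line-stmt-PneNP-2460-c1-0` (2026-08-16). Corollary 3.21 of
arXiv:2501.06427 is, in print, the composition of
* two FIRST-MOMENT obstructions on the `ε`-resampling Markov chain of instances (HS25 Lemma 3.22,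
  ensemble multi-OGP; Lemma 3.23, chaos) — kept as ONE named fact `stub_obstructions` (typed below as
  `KSatEnsembleObstructions`, to be filed under `Literature/` by the lead), and
* GENERIC machinery, all provable now: the grand-correlation inequality of a reversible chain
  (HS25 Lemma 3.15, `stub_grandCorrelation`), the `ε`-resampling kernel on a finite product space —
  stochastic, symmetric (`stub_resampleKernelBasic`), positive (`stub_resamplePositivity`) — and the
  `L²`-stability of low coordinate-degree functions under it (HS25 Prop. 3.14, `stub_resampleStability`,
  via the tree's Hoeffding decomposition `Literature.Probability.Moments.sum_sum_sum_sq_sub_update_le`),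
* the deterministic moat/ladder argument (HS25 Lemmas 3.24–3.25 = BH21 Prop. 4.6 / Lemma 4.8,
  `stub_moat`, over the DartGame toolkit `condEnt`/`withRung` of crux `NoStableSection`), and
* the lead's assembly `stub_hsAssembly` (parameters `ε = log(n/D)/n`, `K = ⌈1/(bε)⌉`, Markov for
  the instability probability, `(p² − u)^{2K}` versus `e^{−cn}`).
So `stub_strongLowDegreeHardness` below is DERIVED; the sorries of its cone are `stub_obstructions`
(named fact) and the provable stubs of this section. -/

/-! ## Cycle 2: discharging the CHAOS half of the obstructions fact (Huang–Sellke 2025, Lemma 3.23)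

Lemma 3.23 is a clean first moment on the resampling chain: for a fixed time tuple
`t 0 ≤ ⋯ ≤ t (j-1) = s < s + Δ = t j` and fixed earlier outputs, the candidates `x` of conditional
overlap entropy `≤ β` given the earlier outputs number `≤ (n+1)^{2^j} e^{nβ}` (DartGame
`card_filter_condEnt_le`), and each of them satisfies the instance at time `s + Δ` with conditional
probability `≤ (1 − (E_Δ/2)^k)^m`, `E_Δ = 1 − (1−ε)^Δ ≥ 1 − e^{−1/(bk)}` (Markov property + the kernel
semigroup `P_ε P_ε' = P_{1−(1−ε)(1−ε')}` + independence of the `m` clauses under resampling from a fixed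
instance); a union bound over `j ≤ k` and the `≤ (K+1)^{k+1}` time tuples finishes, for EVERY
`β < 5 log k / k` — which HS25/BH's `β = β₊ log k/k` satisfies (`β₊ < β_max < κ = 5`). So the named
fact shrinks to the OGP Lemma 3.22 alone (`stub_ensembleOGP`, Literature def
`HuangSellke2025KSatEnsembleOGP` recording `β < 5 log k/k`), and `stub_obstructions` becomes DERIVED
(`stub_chaosAssembly`). Stubs of this section: -/

section Chaos

/-- STUB — LANDED (p119862) — **semigroup of the resampling kernel** (Chapman–Kolmogorov for the
product kernel; O'Donnell 2014 §8.1, `T_ρ T_ρ' = T_{ρρ'}`): `Σ_{y''} P_ε(y,y'') P_ε'(y'',y') =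
P_{1−(1−ε)(1−ε')}(y,y')`. Purely algebraic (no constraint on `ε, ε'`): coordinatewise
`Σ_c ((1−ε)[a=c] + ε/q)((1−ε')[c=b] + ε'/q) = (1−ε)(1−ε')[a=b] + (ε+ε'−εε')/q`, then
`Fintype.prod_sum`. -/
theorem stub_kernelSemigroup {ι Γ : Type*} [Fintype ι] [DecidableEq ι] [Fintype Γ] [DecidableEq Γ]
    [Nonempty Γ] (ε ε' : ℝ) (y y' : ι → Γ) :
    ∑ y'' : ι → Γ, resampleKernel ε y y'' * resampleKernel ε' y'' y' =
      resampleKernel (1 - (1 - ε) * (1 - ε')) y y' :=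
  Summit.PneNP.PneNP.Theorems.stub_kernelSemigroup ε ε' y y'

/-- STUB — LANDED (p120171) — **`Δ`-step paths of the chain have the closed-form kernel
`P_{1−(1−ε)^Δ}`**: the weight of all length-`Δ` paths from `w` to `y'` is `P_{1−(1−ε)^Δ}(w, y')`
(induction on `Δ`, peeling the last step; `hSemi` = `stub_kernelSemigroup`, handed in as a hypothesis). -/
theorem stub_kernelPowPaths
    (hSemi : ∀ {ι Γ : Type} [Fintype ι] [DecidableEq ι] [Fintype Γ] [DecidableEq Γ] [Nonempty Γ]
      (ε ε' : ℝ) (y y' : ι → Γ), ∑ y'' : ι → Γ, resampleKernel ε y y'' * resampleKernel ε' y'' y' =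
        resampleKernel (1 - (1 - ε) * (1 - ε')) y y')
    {ι Γ : Type} [Fintype ι] [DecidableEq ι] [Fintype Γ] [DecidableEq Γ] [Nonempty Γ]
    (ε : ℝ) (Δ : ℕ) (w y' : ι → Γ) :
    ∑ y : Fin (Δ + 1) → ι → Γ,
        (if y 0 = w ∧ y (Fin.last Δ) = y' then
          ∏ t : Fin Δ, resampleKernel ε (y t.castSucc) (y t.succ) else 0)
      = resampleKernel (1 - (1 - ε) ^ Δ) w y' :=
  Summit.PneNP.PneNP.Theorems.stub_kernelPowPaths hSemi ε Δ w y'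

/-- STUB — LANDED (p120280) — **two-block Markov bound for the chain mass**: if `A` depends only on
the path up to time `s` and `B` is a property of the instance at time `s + Δ ≤ K`, then
`mass(A ∧ B(z (s+Δ))) ≤ q · mass(A)` whenever every length-`Δ` segment started anywhere carries `B` at
its end with weight `≤ q` (sum out the times after `s + Δ` by stochasticity, split the path at `s`). -/
theorem stub_chainTwoBlock {ι Γ : Type*} [Fintype ι] [DecidableEq ι] [Fintype Γ] [DecidableEq Γ]
    [Nonempty Γ] (ε : ℝ) (hε0 : 0 ≤ ε) (hε1 : ε ≤ 1) (K s Δ : ℕ) (hsΔ : s + Δ ≤ K)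
    (A : (ℕ → ι → Γ) → Prop) (hA : ∀ z z' : ℕ → ι → Γ, (∀ t ≤ s, z t = z' t) → (A z ↔ A z'))
    (B : (ι → Γ) → Prop) (q : ℝ)
    (hq : ∀ w : ι → Γ, ∑ y : Fin (Δ + 1) → ι → Γ,
        (if y 0 = w then (∏ t : Fin Δ, resampleKernel ε (y t.castSucc) (y t.succ)) *
          (if B (y (Fin.last Δ)) then (1 : ℝ) else 0) else 0) ≤ q) :
    resampleChainMass ε K (fun z => A z ∧ B (z (s + Δ))) ≤ q * resampleChainMass ε K A :=
  Summit.PneNP.PneNP.Theorems.stub_chainTwoBlock ε hε0 hε1 K s Δ hsΔ A hA B q hq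

/-- STUB — LANDED (p119861) — **finite union bound for the chain mass**:
`mass(∃ x, E x) ≤ Σ_x mass(E x)` over a finite index type. -/
theorem stub_chainMassUnion {ι Γ X : Type*} [Fintype ι] [DecidableEq ι] [Fintype Γ] [DecidableEq Γ]
    [Nonempty Γ] [Fintype X] (ε : ℝ) (hε0 : 0 ≤ ε) (hε1 : ε ≤ 1) (K : ℕ)
    (E : X → (ℕ → ι → Γ) → Prop) :
    resampleChainMass ε K (fun z => ∃ x, E x z) ≤ ∑ x, resampleChainMass ε K (E x) :=
  Summit.PneNP.PneNP.Theorems.stub_chainMassUnion ε hε0 hε1 K E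

/-- STUB — LANDED (p120229) — **a fixed assignment satisfies a resampled instance with probability
`≤ (1 − (E/2)^k)^m`**: resampling each literal of a fixed instance `w` independently with probability
`E` (uniformly among the `2n` literals, half of which are true under `x`), every clause stays violated
by `x` with probability `≥ (E/2)^k`, independently over the `m` clauses. -/
theorem stub_satProbBound (n m k : ℕ) (hn : 1 ≤ n) (E : ℝ) (hE0 : 0 ≤ E) (hE1 : E ≤ 1)
    (x : Fin n → Bool) (w : Fin m × Fin k → Fin n × Bool) :
    ∑ y' : Fin m × Fin k → Fin n × Bool, resampleKernel E w y' *
        (if (∀ i : Fin m, ∃ j : Fin k, x (y' (i, j)).1 = (y' (i, j)).2) then (1 : ℝ) else 0)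
      ≤ (1 - (E / 2) ^ k) ^ m :=
  Summit.PneNP.PneNP.Theorems.stub_satProbBound n m k hn E hE0 hE1 x w

/-- STUB — LANDED (p120170) — **few candidates of low conditional overlap entropy** (Bresler–Huang §4.6, the
count behind `S_indep`; = DartGame `card_filter_condEnt_le` transported through the normalisation
`x ↦ x ⊕ prev 0`): for `j ≥ 1` and any earlier rungs `prev 0, …, prev (j-1)`,
`#{x : H(x | prev 0 … prev (j-1)) ≤ β} ≤ (n+1)^{2^j} e^{nβ}`. -/
theorem stub_lowEntropyCount (n j : ℕ) (hj : 1 ≤ j) (prev : ℕ → Fin n → Bool) (β : ℝ) :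
    ((univ.filter fun x : Fin n → Bool =>
        overlapCondEnt (fun ℓ => if ℓ < j then prev ℓ else x) j ≤ β).card : ℝ)
      ≤ ((n : ℝ) + 1) ^ (2 ^ j) * Real.exp (n * β) :=
  Summit.PneNP.PneNP.Theorems.stub_lowEntropyCount n j hj prev β

/-! ### Wave 3b: total mass / weighted counts, the per-tuple bound, the asymptotics, the chaos theorem,
and the glue `EnsembleOGP → Obstructions` (the per-tuple bound and the chaos theorem take the generic
pieces as explicit hypotheses, discharged below by name, so that workers never wait for farm builds) -/

/-- STUB — LANDED (p120160) — **total mass one, and weighted counts**: the chain mass of the sure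
event is `1` (stochasticity, summing out the steps one at a time), hence if every path carries at
most `M` indices `x` with `E x`, then `Σ_x mass(E x) ≤ M`. -/
theorem stub_chainMassTotal {ι Γ : Type*} [Fintype ι] [DecidableEq ι] [Fintype Γ] [DecidableEq Γ]
    [Nonempty Γ] (ε : ℝ) (hε0 : 0 ≤ ε) (hε1 : ε ≤ 1) (K : ℕ) :
    resampleChainMass ε K (fun _ : ℕ → ι → Γ => True) = 1 ∧
    ∀ (X : Type) [Fintype X] (E : X → (ℕ → ι → Γ) → Prop) (M : ℝ),
      (∀ z : ℕ → ι → Γ, ((univ.filter fun x : X => E x z).card : ℝ) ≤ M) →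
      ∑ x : X, resampleChainMass ε K (E x) ≤ M :=
  Summit.PneNP.PneNP.Theorems.stub_chainMassTotal ε hε0 hε1 K

/-- STUB — LANDED (p120579) — **the chaos first moment for ONE time tuple** (Huang–Sellke 2025, proof of
Lemma 3.23 / Bresler–Huang §4.6 `P(S_indep^c)`): earlier rung times `τ 0, …, τ (j−1) ≤ s`, candidate
time `s + Δ ≤ K`; the paths carrying a candidate `x` that satisfies the instance at time `s + Δ` and
has conditional overlap entropy `≤ β` given the outputs `a` at the earlier rung times have mass
`≤ (1 − (E_Δ/2)^k)^m · (n+1)^{2^j} e^{nβ}`, `E_Δ = 1 − (1−ε)^Δ`. The generic inputs are hypotheses: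
`hPow` = `stub_kernelPowPaths`, `hTwoBlock` = `stub_chainTwoBlock`, `hUnion` = `stub_chainMassUnion`,
`hSat` = `stub_satProbBound`, `hCount` = `stub_lowEntropyCount`, `hTotal` = `stub_chainMassTotal`.2. -/
theorem stub_chaosTupleBound
    (hPow : ∀ {ι Γ : Type} [Fintype ι] [DecidableEq ι] [Fintype Γ] [DecidableEq Γ] [Nonempty Γ]
      (ε : ℝ) (Δ : ℕ) (w y' : ι → Γ),
      ∑ y : Fin (Δ + 1) → ι → Γ,
          (if y 0 = w ∧ y (Fin.last Δ) = y' then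
            ∏ t : Fin Δ, resampleKernel ε (y t.castSucc) (y t.succ) else 0)
        = resampleKernel (1 - (1 - ε) ^ Δ) w y')
    (hTwoBlock : ∀ {ι Γ : Type} [Fintype ι] [DecidableEq ι] [Fintype Γ] [DecidableEq Γ] [Nonempty Γ]
      (ε : ℝ), 0 ≤ ε → ε ≤ 1 → ∀ (K s Δ : ℕ), s + Δ ≤ K → ∀ (A : (ℕ → ι → Γ) → Prop),
      (∀ z z' : ℕ → ι → Γ, (∀ t ≤ s, z t = z' t) → (A z ↔ A z')) →
      ∀ (B : (ι → Γ) → Prop) (q : ℝ),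
      (∀ w : ι → Γ, ∑ y : Fin (Δ + 1) → ι → Γ,
          (if y 0 = w then (∏ t : Fin Δ, resampleKernel ε (y t.castSucc) (y t.succ)) *
            (if B (y (Fin.last Δ)) then (1 : ℝ) else 0) else 0) ≤ q) →
      resampleChainMass ε K (fun z => A z ∧ B (z (s + Δ))) ≤ q * resampleChainMass ε K A)
    (hUnion : ∀ {ι Γ X : Type} [Fintype ι] [DecidableEq ι] [Fintype Γ] [DecidableEq Γ] [Nonempty Γ]
      [Fintype X] (ε : ℝ), 0 ≤ ε → ε ≤ 1 → ∀ (K : ℕ) (E : X → (ℕ → ι → Γ) → Prop),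
      resampleChainMass ε K (fun z => ∃ x, E x z) ≤ ∑ x, resampleChainMass ε K (E x))
    (hSat : ∀ (n m k : ℕ), 1 ≤ n → ∀ (E : ℝ), 0 ≤ E → E ≤ 1 → ∀ (x : Fin n → Bool)
      (w : Fin m × Fin k → Fin n × Bool),
      ∑ y' : Fin m × Fin k → Fin n × Bool, resampleKernel E w y' *
          (if (∀ i : Fin m, ∃ j : Fin k, x (y' (i, j)).1 = (y' (i, j)).2) then (1 : ℝ) else 0)
        ≤ (1 - (E / 2) ^ k) ^ m)
    (hCount : ∀ (n j : ℕ), 1 ≤ j → ∀ (prev : ℕ → Fin n → Bool) (β : ℝ),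
      ((univ.filter fun x : Fin n → Bool =>
          overlapCondEnt (fun ℓ => if ℓ < j then prev ℓ else x) j ≤ β).card : ℝ)
        ≤ ((n : ℝ) + 1) ^ (2 ^ j) * Real.exp (n * β))
    (hTotal : ∀ {ι Γ : Type} [Fintype ι] [DecidableEq ι] [Fintype Γ] [DecidableEq Γ] [Nonempty Γ]
      (ε : ℝ), 0 ≤ ε → ε ≤ 1 → ∀ (K : ℕ) (X : Type) [Fintype X] (E : X → (ℕ → ι → Γ) → Prop)
      (M : ℝ), (∀ z : ℕ → ι → Γ, ((univ.filter fun x : X => E x z).card : ℝ) ≤ M) →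
      ∑ x : X, resampleChainMass ε K (E x) ≤ M)
    (n m k : ℕ) (hn : 1 ≤ n) (ε : ℝ) (hε0 : 0 ≤ ε) (hε1 : ε ≤ 1)
    (K j s Δ : ℕ) (hj : 1 ≤ j) (hsΔ : s + Δ ≤ K) (τ : ℕ → ℕ) (hτ : ∀ ℓ < j, τ ℓ ≤ s)
    (a : (Fin m × Fin k → Fin n × Bool) → (Fin n → Bool)) (β : ℝ) :
    resampleChainMass ε K (fun z : ℕ → (Fin m × Fin k → Fin n × Bool) =>
        ∃ x : Fin n → Bool,
          (∀ i : Fin m, ∃ j' : Fin k, x (z (s + Δ) (i, j')).1 = (z (s + Δ) (i, j')).2) ∧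
          overlapCondEnt (fun ℓ => if ℓ < j then a (z (τ ℓ)) else x) j ≤ β)
      ≤ (1 - ((1 - (1 - ε) ^ Δ) / 2) ^ k) ^ m * (((n : ℝ) + 1) ^ (2 ^ j) * Real.exp (n * β)) :=
  Summit.PneNP.PneNP.Theorems.stub_chaosTupleBound hPow hTwoBlock hUnion hSat hCount hTotal n m k hn ε hε0 hε1 K j s Δ hj hsΔ τ hτ a β

/-- STUB — LANDED (p120344) — **the chaos asymptotics**: for `k ≥ 2` and `β < 5 log k / k`
there is `b₁ > 0` such that for `0 < b ≤ b₁` and every exponent `A`, some `c > 0` has, eventually in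
`n`, for all `K ≤ n^A` and all resampling rates `E ∈ [1 − e^{−1/(bk)}, 1]`:
`(k+1)(K+1)^{k+1} (n+1)^{2^k} e^{nβ} (1 − (E/2)^k)^{⌊α_k n⌋} ≤ e^{−cn}`
(`α_k (E/2)^k = 5 E^k log k / k > β` once `(1 − e^{−1/(b₁ k)})^k · 5 log k/k > β`). -/
theorem stub_chaosAsymptotics (k : ℕ) (hk : 2 ≤ k) (β : ℝ) (hβ : β < 5 * Real.log k / k) :
    ∃ b₁ : ℝ, 0 < b₁ ∧ ∀ b : ℝ, 0 < b → b ≤ b₁ → ∀ A : ℕ, ∃ c : ℝ, 0 < c ∧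
      ∀ᶠ n : ℕ in atTop, ∀ K : ℕ, K ≤ n ^ A → ∀ E : ℝ, 1 - Real.exp (-(1 / (b * k))) ≤ E → E ≤ 1 →
        ((k : ℝ) + 1) * ((K : ℝ) + 1) ^ (k + 1) *
            ((((n : ℝ) + 1) ^ (2 ^ k)) * Real.exp (n * β)) *
            (1 - (E / 2) ^ k) ^ ⌊5 * 2 ^ k * Real.log k / k * n⌋₊
          ≤ Real.exp (-(c * n)) :=
  Summit.PneNP.PneNP.Theorems.stub_chaosAsymptotics k hk β hβ

/-- STUB — LANDED (p121096) — **the chaos lemma (Huang–Sellke 2025, Lemma 3.23) as a THEOREM**, for every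
`β < 5 log k / k`: reindex the chaos event by the finitely many pairs (`j`, time tuple in
`Fin (k+1) → Fin (K+1)`), bound each by the per-tuple bound `hTuple` (= `stub_chaosTupleBound`) with
`s = t (j−1)`, `Δ = t j − s` (the gap `t j ≥ t (j−1) + 1/(b k ε)` gives
`(1−ε)^Δ ≤ e^{−εΔ} ≤ e^{−1/(bk)}`), sum (`hUnion` = `stub_chainMassUnion`, `hMono` =
`stub_chainMassBasic`.1), and finish with `hAsy` (= `stub_chaosAsymptotics`); `0 < ε ≤ 1` eventually
from `1 ≤ D = o(n)`. -/
theorem stub_chaosAssembly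
    (hMono : ∀ {ι Γ : Type} [Fintype ι] [DecidableEq ι] [Fintype Γ] [DecidableEq Γ] [Nonempty Γ]
      (ε : ℝ), 0 ≤ ε → ε ≤ 1 → ∀ (K : ℕ) (E E' : (ℕ → ι → Γ) → Prop), (∀ z, E z → E' z) →
      resampleChainMass ε K E ≤ resampleChainMass ε K E')
    (hUnion : ∀ {ι Γ X : Type} [Fintype ι] [DecidableEq ι] [Fintype Γ] [DecidableEq Γ] [Nonempty Γ]
      [Fintype X] (ε : ℝ), 0 ≤ ε → ε ≤ 1 → ∀ (K : ℕ) (E : X → (ℕ → ι → Γ) → Prop),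
      resampleChainMass ε K (fun z => ∃ x, E x z) ≤ ∑ x, resampleChainMass ε K (E x))
    (hTuple : ∀ (n m k : ℕ), 1 ≤ n → ∀ (ε : ℝ), 0 ≤ ε → ε ≤ 1 → ∀ (K j s Δ : ℕ), 1 ≤ j →
      s + Δ ≤ K → ∀ (τ : ℕ → ℕ), (∀ ℓ < j, τ ℓ ≤ s) →
      ∀ (a : (Fin m × Fin k → Fin n × Bool) → (Fin n → Bool)) (β : ℝ),
      resampleChainMass ε K (fun z : ℕ → (Fin m × Fin k → Fin n × Bool) =>
          ∃ x : Fin n → Bool,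
            (∀ i : Fin m, ∃ j' : Fin k, x (z (s + Δ) (i, j')).1 = (z (s + Δ) (i, j')).2) ∧
            overlapCondEnt (fun ℓ => if ℓ < j then a (z (τ ℓ)) else x) j ≤ β)
        ≤ (1 - ((1 - (1 - ε) ^ Δ) / 2) ^ k) ^ m * (((n : ℝ) + 1) ^ (2 ^ j) * Real.exp (n * β)))
    (hAsy : ∀ (k : ℕ), 2 ≤ k → ∀ (β : ℝ), β < 5 * Real.log k / k →
      ∃ b₁ : ℝ, 0 < b₁ ∧ ∀ b : ℝ, 0 < b → b ≤ b₁ → ∀ A : ℕ, ∃ c : ℝ, 0 < c ∧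
        ∀ᶠ n : ℕ in atTop, ∀ K : ℕ, K ≤ n ^ A → ∀ E : ℝ, 1 - Real.exp (-(1 / (b * k))) ≤ E →
          E ≤ 1 →
          ((k : ℝ) + 1) * ((K : ℝ) + 1) ^ (k + 1) *
              ((((n : ℝ) + 1) ^ (2 ^ k)) * Real.exp (n * β)) *
              (1 - (E / 2) ^ k) ^ ⌊5 * 2 ^ k * Real.log k / k * n⌋₊
            ≤ Real.exp (-(c * n))) :
    ∀ k : ℕ, 2 ≤ k → ∀ β : ℝ, β < 5 * Real.log k / k →
    ∃ b₁ : ℝ, 0 < b₁ ∧ ∀ b : ℝ, 0 < b → b ≤ b₁ → ∀ D : ℕ → ℕ,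
      (fun n : ℕ => (D n : ℝ)) =o[atTop] (fun n : ℕ => (n : ℝ)) → (∀ n, 1 ≤ D n) →
      ∀ (a : (n m : ℕ) → (Fin m × Fin k → Fin n × Bool) → (Fin n → Bool)) (A : ℕ),
      ∃ c : ℝ, 0 < c ∧ ∀ᶠ n : ℕ in atTop, ∀ m : ℕ, m = ⌊5 * 2 ^ k * Real.log k / k * n⌋₊ →
        ∀ ε : ℝ, ε = Real.log (n / D n) / n → ∀ K : ℕ, K ≤ n ^ A →
        resampleChainMass ε K (fun y : ℕ → (Fin m × Fin k → Fin n × Bool) =>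
            ∃ (j : ℕ) (t : ℕ → ℕ) (x : Fin n → Bool), 1 ≤ j ∧ j ≤ k ∧
              (∀ ℓ < j, t ℓ ≤ t (ℓ + 1)) ∧ t j ≤ K ∧ (t (j - 1) : ℝ) + 1 / (b * k * ε) ≤ t j ∧
              (∀ i : Fin m, ∃ j' : Fin k, x (y (t j) (i, j')).1 = (y (t j) (i, j')).2) ∧
              overlapCondEnt (fun ℓ => if ℓ < j then a n m (y (t ℓ)) else x) j ≤ β)
          ≤ Real.exp (-(c * n)) :=
  Summit.PneNP.PneNP.Theorems.stub_chaosAssembly hMono hUnion hTuple hAsy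

/-- STUB — LANDED (p120337) — **`EnsembleOGP → Obstructions`**: the OGP half is the smaller named fact
(which records `β < 5 log k / k`), the chaos half is the chaos theorem `hChaos`; take `k₀ ⊔ 2`, the
OGP's `β, η`, the chaos's `b₁`, and `c = min c₁ c₂`. -/
theorem stub_obstructionsOfOGP
    (hOGP : (∃ k₀ : ℕ, ∀ k : ℕ, k₀ ≤ k → ∃ β η : ℝ, 0 < η ∧ η < β ∧ β < 5 * Real.log k / k ∧
      ∀ D : ℕ → ℕ, (fun n : ℕ => (D n : ℝ)) =o[atTop] (fun n : ℕ => (n : ℝ)) → (∀ n, 1 ≤ D n) →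
        ∀ A : ℕ, ∃ c : ℝ, 0 < c ∧ ∀ᶠ n : ℕ in atTop, ∀ m : ℕ, m = ⌊5 * 2 ^ k * Real.log k / k * n⌋₊ →
          ∀ ε : ℝ, ε = Real.log (n / D n) / n → ∀ K : ℕ, K ≤ n ^ A →
          resampleChainMass ε K (fun y : ℕ → (Fin m × Fin k → Fin n × Bool) =>
              ∃ (t : ℕ → ℕ) (x : ℕ → Fin n → Bool), (∀ ℓ < k, t ℓ ≤ t (ℓ + 1)) ∧ t k ≤ K ∧
                (∀ ℓ ≤ k, ∀ i : Fin m, ∃ j : Fin k, x ℓ (y (t ℓ) (i, j)).1 = (y (t ℓ) (i, j)).2) ∧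
                ∀ ℓ, 1 ≤ ℓ → ℓ ≤ k → overlapCondEnt x ℓ ∈ Set.Icc (β - η) β)
            ≤ Real.exp (-(c * n))))
    (hChaos : ∀ k : ℕ, 2 ≤ k → ∀ β : ℝ, β < 5 * Real.log k / k →
      ∃ b₁ : ℝ, 0 < b₁ ∧ ∀ b : ℝ, 0 < b → b ≤ b₁ → ∀ D : ℕ → ℕ,
        (fun n : ℕ => (D n : ℝ)) =o[atTop] (fun n : ℕ => (n : ℝ)) → (∀ n, 1 ≤ D n) →
        ∀ (a : (n m : ℕ) → (Fin m × Fin k → Fin n × Bool) → (Fin n → Bool)) (A : ℕ),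
        ∃ c : ℝ, 0 < c ∧ ∀ᶠ n : ℕ in atTop, ∀ m : ℕ, m = ⌊5 * 2 ^ k * Real.log k / k * n⌋₊ →
          ∀ ε : ℝ, ε = Real.log (n / D n) / n → ∀ K : ℕ, K ≤ n ^ A →
          resampleChainMass ε K (fun y : ℕ → (Fin m × Fin k → Fin n × Bool) =>
              ∃ (j : ℕ) (t : ℕ → ℕ) (x : Fin n → Bool), 1 ≤ j ∧ j ≤ k ∧
                (∀ ℓ < j, t ℓ ≤ t (ℓ + 1)) ∧ t j ≤ K ∧ (t (j - 1) : ℝ) + 1 / (b * k * ε) ≤ t j ∧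
                (∀ i : Fin m, ∃ j' : Fin k, x (y (t j) (i, j')).1 = (y (t j) (i, j')).2) ∧
                overlapCondEnt (fun ℓ => if ℓ < j then a n m (y (t ℓ)) else x) j ≤ β)
            ≤ Real.exp (-(c * n))) :
    HuangSellke2025KSatObstructions :=
  Summit.PneNP.PneNP.Theorems.stub_obstructionsOfOGP hOGP hChaos

/-! ## Cycle c2 (continuation lead `prover-line-stmt-PneNP-2460-c2-0`): the ensemble OGP
(Huang–Sellke 2025, Lemma 3.22) as a THEOREM — literal-level first moment

HS25's printed reduction ("the contribution of any `(t₀,…,t_k)` is upper bounded by the case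
`t₀ = ⋯ = t_k`") is false pointwise for the LITERAL-level resampling chain (a partially refreshed
clause can make the union of the replicas' violation events smaller: anti-correlated pairs, clumped
compatible replicas); Bresler–Huang's own path avoids the issue because a splice point interrupts
`≤ k+1` clause slots (DartGame `stub_pathValidCount`). This section proves L3.22 by a new argument:
finite-dimensional marginal of the chain (M) ⟶ factorisation over clause slots (F) ⟶ mixture over
refresh patterns = admissible block-root maps (R) ⟶ for a fixed pattern, greedy disjointification by
first violated replica, certified against RECENT earlier replicas (sharing `≥ k−F+1` positions) by
pattern newness on `s = k − F` shared darts and against the others by their `≥ F` fresh literals (G)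
⟶ the band gives first-appearance energy with `s` darts via DartGame `en_rung` (E) ⟶ count of
banded tuples (C) ⟶ first moment at one `n` (O) ⟶ parameter asymptotics (A). The lead's composition
`ogp_tupleBound` (M+F+R+G+E) and `ensembleOGP_of_stubs` (O+A) are proved here; M F R G E C O A are
the registered stubs of cycle c2. -/

section EnsembleOGP

/-- STUB M — LANDED (p123661) — **finite-dimensional marginals of the resampling chain** (Markov property + the
closed-form `Δ`-step kernel `P_{1−(1−ε)^Δ}` of `stub_kernelPowPaths` + stationarity of the uniform
start): for times `τ 0 ≤ τ 1 ≤ ⋯ ≤ τ L ≤ K`, the mass of an event reading the path only at the times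
`τ ℓ` is at most (in fact equals) the explicit `(L+1)`-fold sum
`(Σ_x ∏_{ℓ<L} P_{1−(1−ε)^{τ(ℓ+1)−τ ℓ}}(x ℓ, x (ℓ+1)) · [E x]) / #(ι → Γ)`. -/
theorem stub_multiTimeMarginal {ι Γ : Type} [Fintype ι] [DecidableEq ι] [Fintype Γ] [DecidableEq Γ]
    [Nonempty Γ] (ε : ℝ) (hε0 : 0 ≤ ε) (hε1 : ε ≤ 1) (K L : ℕ) (τ : Fin (L + 1) → ℕ)
    (hτ : Monotone τ) (hτK : τ (Fin.last L) ≤ K) (E : (Fin (L + 1) → ι → Γ) → Prop) :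
    resampleChainMass ε K (fun z => E (fun ℓ => z (τ ℓ))) ≤
      (∑ x : Fin (L + 1) → ι → Γ,
        (∏ ℓ : Fin L, resampleKernel (1 - (1 - ε) ^ (τ ℓ.succ - τ ℓ.castSucc))
            (x ℓ.castSucc) (x ℓ.succ)) * (if E x then (1 : ℝ) else 0)) / Fintype.card (ι → Γ) :=
  Summit.PneNP.PneNP.Theorems.stub_multiTimeMarginal ε hε0 hε1 K L τ hτ hτK E

/-- STUB F — LANDED (p123232) — **slot factorisation of the multi-time sums**: on a product index set `A × B` the
resampling kernel is the product over `a : A` of the resampling kernels of the slots `{a} × B`, so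
the multi-time weighted count of an event that is a conjunction over the slots of per-slot events is
the product of the per-slot weighted counts (`Finset.prod_univ_sum` after currying). -/
theorem stub_slotFactorization {A B Γ : Type} [Fintype A] [DecidableEq A] [Fintype B] [DecidableEq B]
    [Fintype Γ] [DecidableEq Γ] (L : ℕ) (δ : Fin L → ℝ) (E : A → (Fin (L + 1) → B → Γ) → Prop) :
    (∑ x : Fin (L + 1) → A × B → Γ,
        (∏ ℓ : Fin L, resampleKernel (δ ℓ) (x ℓ.castSucc) (x ℓ.succ)) *
          (if ∀ a, E a (fun ℓ b => x ℓ (a, b)) then (1 : ℝ) else 0)) =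
      ∏ a : A, ∑ w : Fin (L + 1) → B → Γ,
        (∏ ℓ : Fin L, resampleKernel (δ ℓ) (w ℓ.castSucc) (w ℓ.succ)) *
          (if E a w then (1 : ℝ) else 0) :=
  Summit.PneNP.PneNP.Theorems.stub_slotFactorization L δ E

/-- STUB R — LANDED (p123569) — **refresh expansion / block structure of one slot**: expanding each step of each
coordinate of the slot kernel `∏_b ((1−δ_ℓ)[w ℓ b = w (ℓ+1) b] + δ_ℓ/|Γ|)` into "keep" + "refresh"
writes the multi-time law of the slot as a mixture (weights `∏ (1−δ_ℓ)` / `δ_ℓ`, summing to `1`)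
over refresh patterns; given the pattern, the versions are `w ℓ b = u (ρ b ℓ) b` for a uniformly
random free array `u` and the pattern's block-root map `ρ` (`ρ b ℓ` = first time of the block of
time `ℓ` at coordinate `b`), which is ADMISSIBLE: `ρ b ℓ ≤ ℓ` and `ρ b` is constant on `[ρ b ℓ, ℓ]`.
Hence a bound on the uniform average of `g ∘ expand_ρ` valid for every admissible `ρ` bounds the
weighted sum of `g ≥ 0`. -/
theorem stub_blockExpansion {B Γ : Type} [Fintype B] [DecidableEq B] [Fintype Γ] [DecidableEq Γ]
    [Nonempty Γ] (L : ℕ) (δ : Fin L → ℝ) (hδ0 : ∀ ℓ, 0 ≤ δ ℓ) (hδ1 : ∀ ℓ, δ ℓ ≤ 1)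
    (g : (Fin (L + 1) → B → Γ) → ℝ) (hg : ∀ w, 0 ≤ g w) (M : ℝ)
    (hM : ∀ ρ : B → Fin (L + 1) → Fin (L + 1), (∀ b ℓ, ρ b ℓ ≤ ℓ) →
      (∀ b ℓ ℓ', ρ b ℓ ≤ ℓ' → ℓ' ≤ ℓ → ρ b ℓ' = ρ b ℓ) →
      ∑ u : Fin (L + 1) → B → Γ, g (fun ℓ b => u (ρ b ℓ) b) ≤
        M * Fintype.card (Fin (L + 1) → B → Γ)) :
    ∑ w : Fin (L + 1) → B → Γ,
        (∏ ℓ : Fin L, resampleKernel (δ ℓ) (w ℓ.castSucc) (w ℓ.succ)) * g w ≤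
      M * Fintype.card (B → Γ) :=
  Summit.PneNP.PneNP.Theorems.stub_blockExpansion L δ hδ0 hδ1 g hg M hM

/-- STUB G — LANDED (p124145) — **the literal-level slot bound** (the new combinatorics of this line; replaces
Huang–Sellke's "the contribution of any `(t₀,…,t_k)` is bounded by the case `t₀ = ⋯ = t_k`", which
fails pointwise under per-literal resampling). For an admissible block-root map `ρ` and assignments
`Y 0, …, Y k`, among all free arrays `u : Fin (k+1) → Fin k → Fin n × Bool` (version of position `b`
seen by replica `ℓ` = `u (ρ b ℓ) b`, literal `(v, c)` true under `Y ℓ` iff `Y ℓ v = c`) the fraction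
on which EVERY replica `ℓ` sees a clause it satisfies is at most
`1 − 2^{−k} (FA_s(Y)/n^s − k(k+1)/2 · 2^{−F})`, where `FA_s(Y) = Σ_ℓ #{I : Fin s → Fin n : the
pattern Y ℓ ∘ I differs from every earlier Y ℓ' ∘ I}` is the first-appearance sum with `s` darts,
`s + F ≤ k`. Proof: `#⋃_ℓ V_ℓ = Σ_ℓ #(V_ℓ ∖ ⋃_{ℓ'<ℓ} V_ℓ')` (`V_ℓ` = all `k` versions of replica `ℓ`
false under `Y ℓ`); earlier replicas `ℓ'` with `< F` positions `b` where `ρ b ℓ' ≠ ρ b ℓ` form an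
interval and share a common set of `≥ k − F + 1 ≥ s` positions with `ℓ` (admissibility), on `s` of
which newness of the pattern of `Y ℓ` against all `Y ℓ'` (read at the variables of `ℓ`'s versions)
forces a shared false-under-`Y ℓ` literal to be true under `Y ℓ'`; this costs nothing in signs
(`#(V_ℓ ∧ New_ℓ) = 2^{−k} #New_ℓ = 2^{−k} · #U · ν_ℓ(s)`, variables and signs being independent
halves of `Fin n × Bool`, and the `s` variables i.i.d. uniform); each of the `≤ ℓ` other earlier
replicas has `≥ F` versions at coordinates distinct from `ℓ`'s, all false together with `V_ℓ` only
on a `2^{−k−F}` fraction. -/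
theorem stub_slotBound (n k s F : ℕ) (hn : 1 ≤ n) (hsF : s + F ≤ k)
    (Y : Fin (k + 1) → Fin n → Bool) (ρ : Fin k → Fin (k + 1) → Fin (k + 1))
    (hρ1 : ∀ b ℓ, ρ b ℓ ≤ ℓ) (hρ2 : ∀ b ℓ ℓ', ρ b ℓ ≤ ℓ' → ℓ' ≤ ℓ → ρ b ℓ' = ρ b ℓ) :
    ((univ.filter fun u : Fin (k + 1) → Fin k → Fin n × Bool =>
        ∀ ℓ : Fin (k + 1), ∃ b : Fin k, Y ℓ (u (ρ b ℓ) b).1 = (u (ρ b ℓ) b).2).card : ℝ) ≤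
      (1 - (1 / 2 : ℝ) ^ k *
          ((∑ ℓ : Fin (k + 1), ((univ.filter fun I : Fin s → Fin n =>
              ∀ ℓ' : Fin (k + 1), ℓ' < ℓ → ¬ ∀ r, Y ℓ (I r) = Y ℓ' (I r)).card : ℝ)) / (n : ℝ) ^ s -
            (k : ℝ) * (k + 1) / 2 * (1 / 2 : ℝ) ^ F)) *
        Fintype.card (Fin (k + 1) → Fin k → Fin n × Bool) :=
  Summit.PneNP.PneNP.Theorems.stub_slotBound n k s F hn hsF Y ρ hρ1 hρ2

/-- STUB E — LANDED (p123267) — **the band forces energy** (Bresler–Huang Prop. 5.2 in the DartGame form, with `s`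
darts): if every conditional overlap entropy `H(Y ℓ | Y 0 … Y (ℓ−1))`, `1 ≤ ℓ ≤ k`, is `≥ b ≥ 2θ`,
then the first-appearance sum with `s` darts is
`≥ n^s (1 + k(1 − SB_s(p₀)) − θ k(k+1)/2)`, `SB_s(p) = 2(1−p)^s + s p (1−p)^{s−1}`,
`p₀ = (b − 2θ)/(−log θ)`: the DartGame per-rung bound `en_rung` (whose dart count is free) applied to
the rung-`0`-normalised sequence `(Y j ⊕ Y 0)_j` (`overlapCondEnt = condEnt ∘ normalise`,
`mtr_overlapCondEnt_eq_condEnt`; pattern equality is invariant under the normalisation), summed over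
`ℓ = 1, …, k` (`en_sum_fin_linear`), plus the rung `0` (always new: `n^s`). -/
theorem stub_bandEnergy (n k s : ℕ) (hn : 1 ≤ n) (Y : Fin (k + 1) → Fin n → Bool) (θ b : ℝ)
    (hθ : 0 < θ) (hθ1 : θ < 1) (hb : 2 * θ ≤ b)
    (hband : ∀ ℓ : ℕ, 1 ≤ ℓ → ℓ ≤ k → b ≤ overlapCondEnt (seqOf Y) ℓ) :
    (n : ℝ) ^ s * ((1 : ℝ) + k * (1 - (2 * (1 - (b - 2 * θ) / (-Real.log θ)) ^ s + s * ((b - 2 * θ) / (-Real.log θ)) * (1 - (b - 2 * θ) / (-Real.log θ)) ^ (s - 1))) - θ * ((k : ℝ) * (k + 1) / 2)) ≤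
      (∑ ℓ : Fin (k + 1), ((univ.filter fun I : Fin s → Fin n =>
              ∀ ℓ' : Fin (k + 1), ℓ' < ℓ → ¬ ∀ r, Y ℓ (I r) = Y ℓ' (I r)).card : ℝ)) :=
  Summit.PneNP.PneNP.Theorems.stub_bandEnergy n k s hn Y θ b hθ hθ1 hb hband

/-- STUB C — LANDED (p123268) — **few banded tuples** (method of types, Bresler–Huang §4.6): the tuples
`Y 0, …, Y k` all of whose conditional overlap entropies at rungs `1, …, k` are `≤ β` number at most
`2^n ((n+1)^{2^k} e^{nβ})^k` — iterate `stub_lowEntropyCount` (one rung given any prefix: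
`≤ (n+1)^{2^j} e^{nβ}` candidates) over the rungs, peeling the last rung (`Fin.snocEquiv`), with
the congruence "`overlapCondEnt` at rung `j` reads only rungs `≤ j`". -/
theorem stub_bandCount (n k : ℕ) (β : ℝ) (hβ : 0 ≤ β) :
    ((univ.filter fun Y : Fin (k + 1) → Fin n → Bool =>
        ∀ ℓ : ℕ, 1 ≤ ℓ → ℓ ≤ k → overlapCondEnt (seqOf Y) ℓ ≤ β).card : ℝ) ≤
      (2 : ℝ) ^ n * (((n : ℝ) + 1) ^ (2 ^ k) * Real.exp (n * β)) ^ k :=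
  Summit.PneNP.PneNP.Theorems.stub_bandCount n k β hβ

/-- A first-appearance count with `s` darts is at most `n^s`. -/
theorem ogp_faCard_le (n k s : ℕ) (Y : Fin (k + 1) → Fin n → Bool) (ℓ : Fin (k + 1)) :
    ((univ.filter fun I : Fin s → Fin n =>
        ∀ ℓ' : Fin (k + 1), ℓ' < ℓ → ¬ ∀ r, Y ℓ (I r) = Y ℓ' (I r)).card : ℝ) ≤ (n : ℝ) ^ s := by
  have h := Finset.card_filter_le (univ : Finset (Fin s → Fin n))
    (fun I => ∀ ℓ' : Fin (k + 1), ℓ' < ℓ → ¬ ∀ r, Y ℓ (I r) = Y ℓ' (I r))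
  rw [Finset.card_univ, Fintype.card_fun, Fintype.card_fin, Fintype.card_fin] at h
  exact_mod_cast h

/-- `#(Fin m × Fin k → Γ) = #(Fin k → Γ)^m`. -/
theorem ogp_card_inst (m k : ℕ) (Γ : Type) [Fintype Γ] :
    (Fintype.card (Fin m × Fin k → Γ) : ℝ) = (Fintype.card (Fin k → Γ) : ℝ) ^ m := by
  norm_cast
  rw [Fintype.card_fun, Fintype.card_fun, Fintype.card_prod, Fintype.card_fin, Fintype.card_fin,
    ← pow_mul, mul_comm]

/-- **T — the first moment for ONE time tuple and ONE banded tuple** (composition of stubs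
M, F, R, G, E): for times `τ 0 ≤ ⋯ ≤ τ k ≤ K` and assignments `Y 0, …, Y k` in the LOWER band
(`H(Y ℓ | earlier) ≥ b ≥ 2θ`), the paths on which every `Y ℓ` satisfies the instance at time `τ ℓ`
have mass `≤ base^m`,
`base = 1 − 2^{−k}(1 + k(1 − SB_s(p₀)) − θk(k+1)/2 − k(k+1)/2 · 2^{−F})`. -/
theorem ogp_tupleBound (n m k s F : ℕ) (hn : 1 ≤ n) (hsF : s + F ≤ k) (θ b : ℝ) (hθ : 0 < θ)
    (hθ1 : θ < 1) (hb : 2 * θ ≤ b) (ε : ℝ) (hε0 : 0 ≤ ε) (hε1 : ε ≤ 1) (K : ℕ)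
    (τ : Fin (k + 1) → ℕ) (hτ : Monotone τ) (hτK : τ (Fin.last k) ≤ K)
    (Y : Fin (k + 1) → Fin n → Bool)
    (hband : ∀ ℓ : ℕ, 1 ≤ ℓ → ℓ ≤ k → b ≤ overlapCondEnt (seqOf Y) ℓ) :
    resampleChainMass ε K (fun z : ℕ → (Fin m × Fin k → Fin n × Bool) =>
        ∀ i : Fin m, ∀ ℓ : Fin (k + 1), ∃ j : Fin k, Y ℓ (z (τ ℓ) (i, j)).1 = (z (τ ℓ) (i, j)).2) ≤
      (1 - (1 / 2 : ℝ) ^ k * (((1 : ℝ) + k * (1 - (2 * (1 - (b - 2 * θ) / (-Real.log θ)) ^ s + s * ((b - 2 * θ) / (-Real.log θ)) * (1 - (b - 2 * θ) / (-Real.log θ)) ^ (s - 1))) - θ * ((k : ℝ) * (k + 1) / 2)) - (k : ℝ) * (k + 1) / 2 * (1 / 2 : ℝ) ^ F)) ^ m := by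
  haveI hne : Nonempty (Fin n × Bool) := ⟨(⟨0, hn⟩, true)⟩
  have hnr : (0 : ℝ) < n := by exact_mod_cast hn
  have hns : (0 : ℝ) < (n : ℝ) ^ s := pow_pos hnr s
  have hcpos : 0 < (Fintype.card (Fin k → Fin n × Bool) : ℝ) := by exact_mod_cast Fintype.card_pos
  -- Step E: the band gives energy, so `base' ≤ base`, and `0 ≤ base'`
  have hE := stub_bandEnergy n k s hn Y θ b hθ hθ1 hb hband
  have hpen0 : 0 ≤ (k : ℝ) * (k + 1) / 2 * (1 / 2 : ℝ) ^ F := by positivity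
  have hhalf : (0 : ℝ) ≤ (1 / 2 : ℝ) ^ k := by positivity
  have hFAle : (∑ ℓ : Fin (k + 1), ((univ.filter fun I : Fin s → Fin n =>
              ∀ ℓ' : Fin (k + 1), ℓ' < ℓ → ¬ ∀ r, Y ℓ (I r) = Y ℓ' (I r)).card : ℝ)) ≤ ((k : ℝ) + 1) * (n : ℝ) ^ s := by
    have h := Finset.sum_le_sum (s := (univ : Finset (Fin (k + 1))))
      (fun ℓ _ => ogp_faCard_le n k s Y ℓ)
    simp only [Finset.sum_const, Finset.card_univ, Fintype.card_fin, nsmul_eq_mul] at h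
    push_cast at h
    exact h
  have hFAdiv : (∑ ℓ : Fin (k + 1), ((univ.filter fun I : Fin s → Fin n =>
              ∀ ℓ' : Fin (k + 1), ℓ' < ℓ → ¬ ∀ r, Y ℓ (I r) = Y ℓ' (I r)).card : ℝ)) / (n : ℝ) ^ s ≤ (k : ℝ) + 1 := by
    rw [div_le_iff₀ hns]; exact hFAle
  have hEdiv : ((1 : ℝ) + k * (1 - (2 * (1 - (b - 2 * θ) / (-Real.log θ)) ^ s + s * ((b - 2 * θ) / (-Real.log θ)) * (1 - (b - 2 * θ) / (-Real.log θ)) ^ (s - 1))) - θ * ((k : ℝ) * (k + 1) / 2)) ≤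
      (∑ ℓ : Fin (k + 1), ((univ.filter fun I : Fin s → Fin n =>
              ∀ ℓ' : Fin (k + 1), ℓ' < ℓ → ¬ ∀ r, Y ℓ (I r) = Y ℓ' (I r)).card : ℝ)) / (n : ℝ) ^ s := by
    rw [le_div_iff₀ hns]; linarith
  have hbase'0 : 0 ≤ (1 - (1 / 2 : ℝ) ^ k * ((∑ ℓ : Fin (k + 1), ((univ.filter fun I : Fin s → Fin n =>
              ∀ ℓ' : Fin (k + 1), ℓ' < ℓ → ¬ ∀ r, Y ℓ (I r) = Y ℓ' (I r)).card : ℝ)) / (n : ℝ) ^ s - (k : ℝ) * (k + 1) / 2 * (1 / 2 : ℝ) ^ F)) := by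
    have h2 : ((k : ℝ) + 1) * (1 / 2 : ℝ) ^ k ≤ 1 := by
      have hk2 : ((k : ℝ) + 1) ≤ (2 : ℝ) ^ k := by
        have : k < 2 ^ k := Nat.lt_two_pow_self
        exact_mod_cast this
      calc ((k : ℝ) + 1) * (1 / 2 : ℝ) ^ k ≤ (2 : ℝ) ^ k * (1 / 2 : ℝ) ^ k :=
            mul_le_mul_of_nonneg_right hk2 hhalf
        _ = 1 := by rw [← mul_pow]; norm_num
    have h3 : (1 / 2 : ℝ) ^ k * ((∑ ℓ : Fin (k + 1), ((univ.filter fun I : Fin s → Fin n =>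
              ∀ ℓ' : Fin (k + 1), ℓ' < ℓ → ¬ ∀ r, Y ℓ (I r) = Y ℓ' (I r)).card : ℝ)) / (n : ℝ) ^ s - (k : ℝ) * (k + 1) / 2 * (1 / 2 : ℝ) ^ F) ≤ (1 / 2 : ℝ) ^ k * ((k : ℝ) + 1) :=
      mul_le_mul_of_nonneg_left (by linarith) hhalf
    nlinarith
  have hbase'le : (1 - (1 / 2 : ℝ) ^ k * ((∑ ℓ : Fin (k + 1), ((univ.filter fun I : Fin s → Fin n =>
              ∀ ℓ' : Fin (k + 1), ℓ' < ℓ → ¬ ∀ r, Y ℓ (I r) = Y ℓ' (I r)).card : ℝ)) / (n : ℝ) ^ s - (k : ℝ) * (k + 1) / 2 * (1 / 2 : ℝ) ^ F)) ≤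
      (1 - (1 / 2 : ℝ) ^ k * (((1 : ℝ) + k * (1 - (2 * (1 - (b - 2 * θ) / (-Real.log θ)) ^ s + s * ((b - 2 * θ) / (-Real.log θ)) * (1 - (b - 2 * θ) / (-Real.log θ)) ^ (s - 1))) - θ * ((k : ℝ) * (k + 1) / 2)) - (k : ℝ) * (k + 1) / 2 * (1 / 2 : ℝ) ^ F)) := by
    have h1 : (1 / 2 : ℝ) ^ k * (((1 : ℝ) + k * (1 - (2 * (1 - (b - 2 * θ) / (-Real.log θ)) ^ s + s * ((b - 2 * θ) / (-Real.log θ)) * (1 - (b - 2 * θ) / (-Real.log θ)) ^ (s - 1))) - θ * ((k : ℝ) * (k + 1) / 2)) - (k : ℝ) * (k + 1) / 2 * (1 / 2 : ℝ) ^ F) ≤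
        (1 / 2 : ℝ) ^ k * ((∑ ℓ : Fin (k + 1), ((univ.filter fun I : Fin s → Fin n =>
              ∀ ℓ' : Fin (k + 1), ℓ' < ℓ → ¬ ∀ r, Y ℓ (I r) = Y ℓ' (I r)).card : ℝ)) / (n : ℝ) ^ s - (k : ℝ) * (k + 1) / 2 * (1 / 2 : ℝ) ^ F) :=
      mul_le_mul_of_nonneg_left (by linarith) hhalf
    linarith
  -- Step M: the finite-dimensional marginal at the times `τ`
  have hM := stub_multiTimeMarginal (ι := Fin m × Fin k) (Γ := Fin n × Bool) ε hε0 hε1 K k τ hτ hτK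
    (fun x => ∀ i : Fin m, ∀ ℓ : Fin (k + 1), ∃ j : Fin k, Y ℓ (x ℓ (i, j)).1 = (x ℓ (i, j)).2)
  refine hM.trans ?_
  -- the rates `δ ℓ = 1 − (1−ε)^{τ(ℓ+1) − τ ℓ}` lie in `[0, 1]`
  have hδ0 : ∀ ℓ : Fin k, 0 ≤ 1 - (1 - ε) ^ (τ ℓ.succ - τ ℓ.castSucc) := fun ℓ =>
    sub_nonneg.2 (pow_le_one₀ (sub_nonneg.2 hε1) (by linarith))
  have hδ1 : ∀ ℓ : Fin k, 1 - (1 - ε) ^ (τ ℓ.succ - τ ℓ.castSucc) ≤ 1 := fun ℓ =>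
    sub_le_self _ (pow_nonneg (sub_nonneg.2 hε1) _)
  -- Step F: factorise over the `m` clause slots
  have hF := stub_slotFactorization (A := Fin m) (B := Fin k) (Γ := Fin n × Bool) k
    (fun ℓ => 1 - (1 - ε) ^ (τ ℓ.succ - τ ℓ.castSucc))
    (fun (_ : Fin m) w => ∀ ℓ : Fin (k + 1), ∃ j : Fin k, Y ℓ (w ℓ j).1 = (w ℓ j).2)
  -- Steps R + G: every slot factor is `≤ base' · #(Fin k → Γ)`
  have hslot : (∑ w : Fin (k + 1) → Fin k → Fin n × Bool,
      (∏ ℓ : Fin k, resampleKernel (1 - (1 - ε) ^ (τ ℓ.succ - τ ℓ.castSucc))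
          (w ℓ.castSucc) (w ℓ.succ)) *
        @ite ℝ (∀ ℓ : Fin (k + 1), ∃ j : Fin k, Y ℓ (w ℓ j).1 = (w ℓ j).2)
          (Classical.propDecidable _) 1 0) ≤
      (1 - (1 / 2 : ℝ) ^ k * ((∑ ℓ : Fin (k + 1), ((univ.filter fun I : Fin s → Fin n =>
              ∀ ℓ' : Fin (k + 1), ℓ' < ℓ → ¬ ∀ r, Y ℓ (I r) = Y ℓ' (I r)).card : ℝ)) / (n : ℝ) ^ s - (k : ℝ) * (k + 1) / 2 * (1 / 2 : ℝ) ^ F)) *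
        (Fintype.card (Fin k → Fin n × Bool) : ℝ) := by
    refine stub_blockExpansion (B := Fin k) (Γ := Fin n × Bool) k
      (fun ℓ => 1 - (1 - ε) ^ (τ ℓ.succ - τ ℓ.castSucc)) hδ0 hδ1
      (fun w => @ite ℝ (∀ ℓ : Fin (k + 1), ∃ j : Fin k, Y ℓ (w ℓ j).1 = (w ℓ j).2)
          (Classical.propDecidable _) 1 0)
      (fun w => by positivity) _ (fun ρ hρ1 hρ2 => ?_)
    have hG := stub_slotBound n k s F hn hsF Y ρ hρ1 hρ2
    refine le_trans (le_of_eq ?_) hG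
    rw [Finset.natCast_card_filter]
    refine Finset.sum_congr rfl fun u _ => ?_
    simp only []
    congr 1
  -- nonnegativity of the slot factors
  have hslot0 : 0 ≤ (∑ w : Fin (k + 1) → Fin k → Fin n × Bool,
      (∏ ℓ : Fin k, resampleKernel (1 - (1 - ε) ^ (τ ℓ.succ - τ ℓ.castSucc))
          (w ℓ.castSucc) (w ℓ.succ)) *
        @ite ℝ (∀ ℓ : Fin (k + 1), ∃ j : Fin k, Y ℓ (w ℓ j).1 = (w ℓ j).2)
          (Classical.propDecidable _) 1 0) :=
    Finset.sum_nonneg fun w _ => mul_nonneg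
      (Finset.prod_nonneg fun ℓ _ => cmb_kernel_nonneg _ (hδ0 ℓ) (hδ1 ℓ) _ _) (by positivity)
  -- assemble: numerator = product of slot factors ≤ (base' c)^m, denominator = c^m
  have hnum : (∑ x : Fin (k + 1) → Fin m × Fin k → Fin n × Bool,
      (∏ ℓ : Fin k, resampleKernel (1 - (1 - ε) ^ (τ ℓ.succ - τ ℓ.castSucc))
          (x ℓ.castSucc) (x ℓ.succ)) *
        @ite ℝ (∀ i : Fin m, ∀ ℓ : Fin (k + 1), ∃ j : Fin k, Y ℓ (x ℓ (i, j)).1 = (x ℓ (i, j)).2)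
          (Classical.propDecidable _) 1 0) ≤
      ((1 - (1 / 2 : ℝ) ^ k * ((∑ ℓ : Fin (k + 1), ((univ.filter fun I : Fin s → Fin n =>
              ∀ ℓ' : Fin (k + 1), ℓ' < ℓ → ¬ ∀ r, Y ℓ (I r) = Y ℓ' (I r)).card : ℝ)) / (n : ℝ) ^ s - (k : ℝ) * (k + 1) / 2 * (1 / 2 : ℝ) ^ F)) *
        (Fintype.card (Fin k → Fin n × Bool) : ℝ)) ^ m := by
    calc (∑ x : Fin (k + 1) → Fin m × Fin k → Fin n × Bool,
      (∏ ℓ : Fin k, resampleKernel (1 - (1 - ε) ^ (τ ℓ.succ - τ ℓ.castSucc))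
          (x ℓ.castSucc) (x ℓ.succ)) *
        @ite ℝ (∀ i : Fin m, ∀ ℓ : Fin (k + 1), ∃ j : Fin k, Y ℓ (x ℓ (i, j)).1 = (x ℓ (i, j)).2)
          (Classical.propDecidable _) 1 0)
        = _ := Finset.sum_congr rfl fun x _ => by simp only []; congr 1; exact cmb_ite_congr Iff.rfl
      _ = _ := hF
      _ ≤ ∏ _a : Fin m, ((1 - (1 / 2 : ℝ) ^ k * ((∑ ℓ : Fin (k + 1), ((univ.filter fun I : Fin s → Fin n =>
              ∀ ℓ' : Fin (k + 1), ℓ' < ℓ → ¬ ∀ r, Y ℓ (I r) = Y ℓ' (I r)).card : ℝ)) / (n : ℝ) ^ s - (k : ℝ) * (k + 1) / 2 * (1 / 2 : ℝ) ^ F)) *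
        (Fintype.card (Fin k → Fin n × Bool) : ℝ)) :=
          Finset.prod_le_prod (fun _ _ => hslot0) (fun _ _ => hslot)
      _ = _ := by rw [Finset.prod_const, Finset.card_univ, Fintype.card_fin]
  have hden : (Fintype.card (Fin m × Fin k → Fin n × Bool) : ℝ) = (Fintype.card (Fin k → Fin n × Bool) : ℝ) ^ m :=
    ogp_card_inst m k (Fin n × Bool)
  rw [hden, div_le_iff₀ (pow_pos hcpos m)]
  calc _ ≤ _ := hnum
    _ = (1 - (1 / 2 : ℝ) ^ k * ((∑ ℓ : Fin (k + 1), ((univ.filter fun I : Fin s → Fin n =>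
              ∀ ℓ' : Fin (k + 1), ℓ' < ℓ → ¬ ∀ r, Y ℓ (I r) = Y ℓ' (I r)).card : ℝ)) / (n : ℝ) ^ s - (k : ℝ) * (k + 1) / 2 * (1 / 2 : ℝ) ^ F)) ^ m *
        (Fintype.card (Fin k → Fin n × Bool) : ℝ) ^ m := mul_pow _ _ _
    _ ≤ _ := mul_le_mul_of_nonneg_right (pow_le_pow_left₀ hbase'0 hbase'le m)
        (pow_nonneg hcpos.le m)

/-! ## Reindexing -/

/-- **The OGP event of ONE pair** (time tuple `τ'`, assignment tuple `Y`): monotone times, the band for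
`seqOf Y`, and every `Y ℓ` satisfying the instance at time `τ' ℓ`. A path carrying an OGP structure
carries the event of the pair (`τ' ℓ := t ℓ`, `Y ℓ := x ℓ`). -/
theorem ogc_incl (n m k K : ℕ) (β η : ℝ) (z : ℕ → (Fin m × Fin k → Fin n × Bool))
    (hz : ∃ (t : ℕ → ℕ) (x : ℕ → Fin n → Bool), (∀ ℓ < k, t ℓ ≤ t (ℓ + 1)) ∧ t k ≤ K ∧
        (∀ ℓ ≤ k, ∀ i : Fin m, ∃ j : Fin k, x ℓ (z (t ℓ) (i, j)).1 = (z (t ℓ) (i, j)).2) ∧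
        ∀ ℓ, 1 ≤ ℓ → ℓ ≤ k → overlapCondEnt x ℓ ∈ Set.Icc (β - η) β) :
    ∃ τ' : Fin (k + 1) → Fin (K + 1), ∃ Y : Fin (k + 1) → Fin n → Bool,
      Monotone τ' ∧
      (∀ ℓ : ℕ, 1 ≤ ℓ → ℓ ≤ k → overlapCondEnt (seqOf Y) ℓ ∈ Set.Icc (β - η) β) ∧
      ∀ i : Fin m, ∀ ℓ : Fin (k + 1), ∃ j : Fin k,
        Y ℓ (z (τ' ℓ : ℕ) (i, j)).1 = (z (τ' ℓ : ℕ) (i, j)).2 := by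
  obtain ⟨t, x, hmono, htK, hsat, hband⟩ := hz
  have hpre : ∀ ℓ ≤ k, t ℓ ≤ t k := cas_mono_prefix t k hmono
  have hbd : ∀ ℓ : Fin (k + 1), t ℓ < K + 1 := fun ℓ =>
    Nat.lt_succ_of_le ((hpre ℓ (Nat.le_of_lt_succ ℓ.isLt)).trans htK)
  refine ⟨fun ℓ => ⟨t ℓ, hbd ℓ⟩, fun ℓ => x ℓ, ?_, ?_, ?_⟩
  · -- monotone times
    intro ℓ₁ ℓ₂ hle
    show (⟨t ℓ₁, hbd ℓ₁⟩ : Fin (K + 1)) ≤ ⟨t ℓ₂, hbd ℓ₂⟩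
    rw [Fin.mk_le_mk]
    have h2 : (ℓ₂ : ℕ) ≤ k := Nat.le_of_lt_succ ℓ₂.isLt
    exact cas_mono_prefix t ℓ₂ (fun ℓ' hℓ' => hmono ℓ' (lt_of_lt_of_le hℓ' h2)) ℓ₁ hle
  · -- the band transfers to `seqOf Y` (congruence at indices `≤ ℓ ≤ k`)
    intro ℓ h1 hℓk
    have hce : overlapCondEnt (seqOf fun ℓ' : Fin (k + 1) => x ℓ') ℓ = overlapCondEnt x ℓ :=
      bct_overlapCondEnt_congr fun j hj => by
        rw [seqOf_apply_lt _ (show j < k + 1 by omega)]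
    rw [hce]
    exact hband ℓ h1 hℓk
  · -- satisfaction at every rung
    intro i ℓ
    exact hsat ℓ (Nat.le_of_lt_succ ℓ.isLt) i

/-! ## The bound for one pair, and the sum over pairs -/

/-- **Mass of the event of one pair** `≤ [upper band] · base^m`: empty unless the times are monotone and
the tuple is in the band; then drop the side conditions (`hMono`) and apply the per-tuple first moment
`hTuple` with the lower band (`b = β − η`). -/
theorem ogc_pair_bound
    (hMono : ∀ {ι Γ : Type} [Fintype ι] [DecidableEq ι] [Fintype Γ] [DecidableEq Γ] [Nonempty Γ]
      (ε : ℝ), 0 ≤ ε → ε ≤ 1 → ∀ (K : ℕ) (E E' : (ℕ → ι → Γ) → Prop), (∀ z, E z → E' z) →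
      resampleChainMass ε K E ≤ resampleChainMass ε K E')
    (hTuple : ∀ (n m k s F : ℕ), 1 ≤ n → s + F ≤ k → ∀ (θ b : ℝ), 0 < θ → θ < 1 → 2 * θ ≤ b →
      ∀ (ε : ℝ), 0 ≤ ε → ε ≤ 1 → ∀ (K : ℕ) (τ : Fin (k + 1) → ℕ), Monotone τ → τ (Fin.last k) ≤ K →
      ∀ (Y : Fin (k + 1) → Fin n → Bool),
      (∀ ℓ : ℕ, 1 ≤ ℓ → ℓ ≤ k → b ≤ overlapCondEnt (seqOf Y) ℓ) →
      resampleChainMass ε K (fun z : ℕ → (Fin m × Fin k → Fin n × Bool) =>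
        ∀ i : Fin m, ∀ ℓ : Fin (k + 1), ∃ j : Fin k, Y ℓ (z (τ ℓ) (i, j)).1 = (z (τ ℓ) (i, j)).2) ≤
      (1 - (1 / 2 : ℝ) ^ k * (((1 : ℝ) + k * (1 - (2 * (1 - (b - 2 * θ) / (-Real.log θ)) ^ s + s * ((b - 2 * θ) / (-Real.log θ)) * (1 - (b - 2 * θ) / (-Real.log θ)) ^ (s - 1))) - θ * ((k : ℝ) * (k + 1) / 2)) - (k : ℝ) * (k + 1) / 2 * (1 / 2 : ℝ) ^ F)) ^ m)
    (n m k K s F : ℕ) (hn : 1 ≤ n) (hsF : s + F ≤ k) (ε : ℝ) (hε0 : 0 ≤ ε) (hε1 : ε ≤ 1)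
    (β η θ : ℝ) (hθ : 0 < θ) (hθ1 : θ < 1) (hb : 2 * θ ≤ β - η)
    (hbase : 0 ≤ (1 - (1 / 2 : ℝ) ^ k * (((1 : ℝ) + k * (1 - (2 * (1 - (β - η - 2 * θ) / (-Real.log θ)) ^ s + s * ((β - η - 2 * θ) / (-Real.log θ)) * (1 - (β - η - 2 * θ) / (-Real.log θ)) ^ (s - 1))) - θ * ((k : ℝ) * (k + 1) / 2)) - (k : ℝ) * (k + 1) / 2 * (1 / 2 : ℝ) ^ F)))
    (τ' : Fin (k + 1) → Fin (K + 1)) (Y : Fin (k + 1) → Fin n → Bool) :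
    resampleChainMass ε K (fun z : ℕ → (Fin m × Fin k → Fin n × Bool) =>
        Monotone τ' ∧
        (∀ ℓ : ℕ, 1 ≤ ℓ → ℓ ≤ k → overlapCondEnt (seqOf Y) ℓ ∈ Set.Icc (β - η) β) ∧
        ∀ i : Fin m, ∀ ℓ : Fin (k + 1), ∃ j : Fin k,
          Y ℓ (z (τ' ℓ : ℕ) (i, j)).1 = (z (τ' ℓ : ℕ) (i, j)).2) ≤
      (if (∀ ℓ : ℕ, 1 ≤ ℓ → ℓ ≤ k → overlapCondEnt (seqOf Y) ℓ ≤ β) then (1 : ℝ) else 0) *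
        (1 - (1 / 2 : ℝ) ^ k * (((1 : ℝ) + k * (1 - (2 * (1 - (β - η - 2 * θ) / (-Real.log θ)) ^ s + s * ((β - η - 2 * θ) / (-Real.log θ)) * (1 - (β - η - 2 * θ) / (-Real.log θ)) ^ (s - 1))) - θ * ((k : ℝ) * (k + 1) / 2)) - (k : ℝ) * (k + 1) / 2 * (1 / 2 : ℝ) ^ F)) ^ m := by
  haveI : Nonempty (Fin n × Bool) := ⟨(⟨0, hn⟩, true)⟩
  have hBm : 0 ≤ (1 - (1 / 2 : ℝ) ^ k * (((1 : ℝ) + k * (1 - (2 * (1 - (β - η - 2 * θ) / (-Real.log θ)) ^ s + s * ((β - η - 2 * θ) / (-Real.log θ)) * (1 - (β - η - 2 * θ) / (-Real.log θ)) ^ (s - 1))) - θ * ((k : ℝ) * (k + 1) / 2)) - (k : ℝ) * (k + 1) / 2 * (1 / 2 : ℝ) ^ F)) ^ m := pow_nonneg hbase m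
  by_cases hside : Monotone τ' ∧
      ∀ ℓ : ℕ, 1 ≤ ℓ → ℓ ≤ k → overlapCondEnt (seqOf Y) ℓ ∈ Set.Icc (β - η) β
  · obtain ⟨hmn, hband⟩ := hside
    have hup : ∀ ℓ : ℕ, 1 ≤ ℓ → ℓ ≤ k → overlapCondEnt (seqOf Y) ℓ ≤ β :=
      fun ℓ h1 h2 => (hband ℓ h1 h2).2
    rw [if_pos hup, one_mul]
    have hτmono : Monotone fun ℓ : Fin (k + 1) => (τ' ℓ : ℕ) :=
      fun a b hab => by exact_mod_cast hmn hab
    have hτK : ((fun ℓ : Fin (k + 1) => (τ' ℓ : ℕ)) (Fin.last k)) ≤ K :=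
      Nat.le_of_lt_succ (τ' (Fin.last k)).isLt
    have h1 := hTuple n m k s F hn hsF θ (β - η) hθ hθ1 hb ε hε0 hε1 K
      (fun ℓ => (τ' ℓ : ℕ)) hτmono hτK Y (fun ℓ h1 h2 => (hband ℓ h1 h2).1)
    refine le_trans (hMono ε hε0 hε1 K _ _ fun z hz => ?_) h1
    exact hz.2.2
  · -- the side conditions fail: the event is empty
    refine le_trans (hMono ε hε0 hε1 K _
      (fun _ : ℕ → (Fin m × Fin k → Fin n × Bool) => False) fun z hz => ?_) ?_
    · exact hside ⟨hz.1, hz.2.1⟩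
    · rw [cas_mass_false]
      positivity

/-- STUB O — LANDED (p124260; proof INLINED here only because the farm build of
`…OgpCore` lags at registration time) — **the OGP first moment at one instance size**: `mass(OGP) ≤ (K+1)^{k+1} · 2^n ((n+1)^{2^k} e^{nβ})^k · base^m` — reindex by the pairs
(`ogc_incl`, `hMono`), union bound (`hUnion`), bound each pair (`ogc_pair_bound` with `hTuple`), count
the time tuples and, with `hCount`, the banded assignment tuples. -/
theorem stub_ogpCore
    (hMono : ∀ {ι Γ : Type} [Fintype ι] [DecidableEq ι] [Fintype Γ] [DecidableEq Γ] [Nonempty Γ]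
      (ε : ℝ), 0 ≤ ε → ε ≤ 1 → ∀ (K : ℕ) (E E' : (ℕ → ι → Γ) → Prop), (∀ z, E z → E' z) →
      resampleChainMass ε K E ≤ resampleChainMass ε K E')
    (hUnion : ∀ {ι Γ X : Type} [Fintype ι] [DecidableEq ι] [Fintype Γ] [DecidableEq Γ] [Nonempty Γ]
      [Fintype X] (ε : ℝ), 0 ≤ ε → ε ≤ 1 → ∀ (K : ℕ) (E : X → (ℕ → ι → Γ) → Prop),
      resampleChainMass ε K (fun z => ∃ x, E x z) ≤ ∑ x, resampleChainMass ε K (E x))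
    (hTuple : ∀ (n m k s F : ℕ), 1 ≤ n → s + F ≤ k → ∀ (θ b : ℝ), 0 < θ → θ < 1 → 2 * θ ≤ b →
      ∀ (ε : ℝ), 0 ≤ ε → ε ≤ 1 → ∀ (K : ℕ) (τ : Fin (k + 1) → ℕ), Monotone τ → τ (Fin.last k) ≤ K →
      ∀ (Y : Fin (k + 1) → Fin n → Bool),
      (∀ ℓ : ℕ, 1 ≤ ℓ → ℓ ≤ k → b ≤ overlapCondEnt (seqOf Y) ℓ) →
      resampleChainMass ε K (fun z : ℕ → (Fin m × Fin k → Fin n × Bool) =>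
        ∀ i : Fin m, ∀ ℓ : Fin (k + 1), ∃ j : Fin k, Y ℓ (z (τ ℓ) (i, j)).1 = (z (τ ℓ) (i, j)).2) ≤
      (1 - (1 / 2 : ℝ) ^ k * (((1 : ℝ) + k * (1 - (2 * (1 - (b - 2 * θ) / (-Real.log θ)) ^ s + s * ((b - 2 * θ) / (-Real.log θ)) * (1 - (b - 2 * θ) / (-Real.log θ)) ^ (s - 1))) - θ * ((k : ℝ) * (k + 1) / 2)) - (k : ℝ) * (k + 1) / 2 * (1 / 2 : ℝ) ^ F)) ^ m)
    (hCount : ∀ (n k : ℕ) (β : ℝ), 0 ≤ β →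
      ((univ.filter fun Y : Fin (k + 1) → Fin n → Bool =>
          ∀ ℓ : ℕ, 1 ≤ ℓ → ℓ ≤ k → overlapCondEnt (seqOf Y) ℓ ≤ β).card : ℝ) ≤
        (2 : ℝ) ^ n * (((n : ℝ) + 1) ^ (2 ^ k) * Real.exp (n * β)) ^ k)
    (n m k K s F : ℕ) (hn : 1 ≤ n) (hk : 1 ≤ k) (hsF : s + F ≤ k) (ε : ℝ) (hε0 : 0 ≤ ε) (hε1 : ε ≤ 1)
    (β η θ : ℝ) (hβ : 0 ≤ β) (hθ : 0 < θ) (hθ1 : θ < 1) (hb : 2 * θ ≤ β - η)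
    (hbase : 0 ≤ (1 - (1 / 2 : ℝ) ^ k * (((1 : ℝ) + k * (1 - (2 * (1 - (β - η - 2 * θ) / (-Real.log θ)) ^ s + s * ((β - η - 2 * θ) / (-Real.log θ)) * (1 - (β - η - 2 * θ) / (-Real.log θ)) ^ (s - 1))) - θ * ((k : ℝ) * (k + 1) / 2)) - (k : ℝ) * (k + 1) / 2 * (1 / 2 : ℝ) ^ F))) :
    resampleChainMass ε K (fun y : ℕ → (Fin m × Fin k → Fin n × Bool) =>
        ∃ (t : ℕ → ℕ) (x : ℕ → Fin n → Bool), (∀ ℓ < k, t ℓ ≤ t (ℓ + 1)) ∧ t k ≤ K ∧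
          (∀ ℓ ≤ k, ∀ i : Fin m, ∃ j : Fin k, x ℓ (y (t ℓ) (i, j)).1 = (y (t ℓ) (i, j)).2) ∧
          ∀ ℓ, 1 ≤ ℓ → ℓ ≤ k → overlapCondEnt x ℓ ∈ Set.Icc (β - η) β) ≤
      ((K : ℝ) + 1) ^ (k + 1) * ((2 : ℝ) ^ n * (((n : ℝ) + 1) ^ (2 ^ k) * Real.exp (n * β)) ^ k) *
          (1 - (1 / 2 : ℝ) ^ k * (((1 : ℝ) + k * (1 - (2 * (1 - (β - η - 2 * θ) / (-Real.log θ)) ^ s + s * ((β - η - 2 * θ) / (-Real.log θ)) * (1 - (β - η - 2 * θ) / (-Real.log θ)) ^ (s - 1))) - θ * ((k : ℝ) * (k + 1) / 2)) - (k : ℝ) * (k + 1) / 2 * (1 / 2 : ℝ) ^ F)) ^ m := by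
  haveI : Nonempty (Fin n × Bool) := ⟨(⟨0, hn⟩, true)⟩
  have _hk := hk
  have hBm : 0 ≤ (1 - (1 / 2 : ℝ) ^ k * (((1 : ℝ) + k * (1 - (2 * (1 - (β - η - 2 * θ) / (-Real.log θ)) ^ s + s * ((β - η - 2 * θ) / (-Real.log θ)) * (1 - (β - η - 2 * θ) / (-Real.log θ)) ^ (s - 1))) - θ * ((k : ℝ) * (k + 1) / 2)) - (k : ℝ) * (k + 1) / 2 * (1 / 2 : ℝ) ^ F)) ^ m := pow_nonneg hbase m
  -- reindex by (time tuple, assignment tuple) and union-bound twice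
  have h1 := hMono ε hε0 hε1 K _ _ fun z hz => ogc_incl n m k K β η z hz
  have h2 := hUnion (X := Fin (k + 1) → Fin (K + 1)) ε hε0 hε1 K
    (fun τ' (z : ℕ → (Fin m × Fin k → Fin n × Bool)) => ∃ Y : Fin (k + 1) → Fin n → Bool,
      Monotone τ' ∧
      (∀ ℓ : ℕ, 1 ≤ ℓ → ℓ ≤ k → overlapCondEnt (seqOf Y) ℓ ∈ Set.Icc (β - η) β) ∧
      ∀ i : Fin m, ∀ ℓ : Fin (k + 1), ∃ j : Fin k,
        Y ℓ (z (τ' ℓ : ℕ) (i, j)).1 = (z (τ' ℓ : ℕ) (i, j)).2)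
  have h3 : ∀ τ' : Fin (k + 1) → Fin (K + 1),
      resampleChainMass ε K (fun z : ℕ → (Fin m × Fin k → Fin n × Bool) =>
        ∃ Y : Fin (k + 1) → Fin n → Bool, Monotone τ' ∧
          (∀ ℓ : ℕ, 1 ≤ ℓ → ℓ ≤ k → overlapCondEnt (seqOf Y) ℓ ∈ Set.Icc (β - η) β) ∧
          ∀ i : Fin m, ∀ ℓ : Fin (k + 1), ∃ j : Fin k,
            Y ℓ (z (τ' ℓ : ℕ) (i, j)).1 = (z (τ' ℓ : ℕ) (i, j)).2) ≤
      ∑ Y : Fin (k + 1) → Fin n → Bool,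
        (if (∀ ℓ : ℕ, 1 ≤ ℓ → ℓ ≤ k → overlapCondEnt (seqOf Y) ℓ ≤ β) then (1 : ℝ) else 0) *
          (1 - (1 / 2 : ℝ) ^ k * (((1 : ℝ) + k * (1 - (2 * (1 - (β - η - 2 * θ) / (-Real.log θ)) ^ s + s * ((β - η - 2 * θ) / (-Real.log θ)) * (1 - (β - η - 2 * θ) / (-Real.log θ)) ^ (s - 1))) - θ * ((k : ℝ) * (k + 1) / 2)) - (k : ℝ) * (k + 1) / 2 * (1 / 2 : ℝ) ^ F)) ^ m :=
    fun τ' => (hUnion (X := Fin (k + 1) → Fin n → Bool) ε hε0 hε1 K _).trans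
      (Finset.sum_le_sum fun Y _ =>
        ogc_pair_bound hMono hTuple n m k K s F hn hsF ε hε0 hε1 β η θ hθ hθ1 hb hbase τ' Y)
  refine h1.trans (h2.trans ((Finset.sum_le_sum fun τ' _ => h3 τ').trans ?_))
  -- count: `(K+1)^(k+1)` time tuples, `hCount` banded assignment tuples
  rw [Finset.sum_const, Finset.card_univ, nsmul_eq_mul, ← Finset.sum_mul, Finset.sum_boole]
  have hcardT : (Fintype.card (Fin (k + 1) → Fin (K + 1)) : ℝ) = ((K : ℝ) + 1) ^ (k + 1) := by
    rw [Fintype.card_fun, Fintype.card_fin, Fintype.card_fin]; push_cast; ring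
  rw [hcardT]
  have hC := hCount n k β hβ
  have hT : (0 : ℝ) ≤ ((K : ℝ) + 1) ^ (k + 1) := by positivity
  calc ((K : ℝ) + 1) ^ (k + 1) *
        (((univ.filter fun Y : Fin (k + 1) → Fin n → Bool =>
            ∀ ℓ : ℕ, 1 ≤ ℓ → ℓ ≤ k → overlapCondEnt (seqOf Y) ℓ ≤ β).card : ℝ) *
          (1 - (1 / 2 : ℝ) ^ k * (((1 : ℝ) + k * (1 - (2 * (1 - (β - η - 2 * θ) / (-Real.log θ)) ^ s + s * ((β - η - 2 * θ) / (-Real.log θ)) * (1 - (β - η - 2 * θ) / (-Real.log θ)) ^ (s - 1))) - θ * ((k : ℝ) * (k + 1) / 2)) - (k : ℝ) * (k + 1) / 2 * (1 / 2 : ℝ) ^ F)) ^ m)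
      ≤ ((K : ℝ) + 1) ^ (k + 1) *
        (((2 : ℝ) ^ n * (((n : ℝ) + 1) ^ (2 ^ k) * Real.exp (n * β)) ^ k) *
          (1 - (1 / 2 : ℝ) ^ k * (((1 : ℝ) + k * (1 - (2 * (1 - (β - η - 2 * θ) / (-Real.log θ)) ^ s + s * ((β - η - 2 * θ) / (-Real.log θ)) * (1 - (β - η - 2 * θ) / (-Real.log θ)) ^ (s - 1))) - θ * ((k : ℝ) * (k + 1) / 2)) - (k : ℝ) * (k + 1) / 2 * (1 / 2 : ℝ) ^ F)) ^ m) :=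
        mul_le_mul_of_nonneg_left (mul_le_mul_of_nonneg_right hC hBm) hT
    _ = _ := by ring


/-- STUB A — LANDED (p123592) — **the parameter asymptotics** (real analysis only; mirror of DartGame `glue_KA` +
`stub_chaosAsymptotics`): a choice of the band `[β − η, β]` below `5 log k/k`, the truncation level
`θ`, the dart count `s` and the freshness threshold `F` (suggested: `β = 2.7 log k/k`,
`η = 0.1 log k/k`, `θ = 1/(k log² k)`, `2^F ≥ 10(k+1)` minimal, `s = k − F`) for which, for every
large `k`, the first-moment bound of `stub_ogpCore` is exponentially small, uniformly in the chain
length `K ≤ n^A`: with `SB_s(p₀) → 4.6 e^{−2.6} ≈ 0.342`, the kill exponent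
`5 log k/k · (1 + k(1 − SB) − θk(k+1)/2 − k(k+1)2^{−F}/2) ≥ (3.0 + o(1)) log k` beats the count
exponent `log 2 + 2.7 log k + o(1)`; polynomial factors are absorbed eventually in `n`. -/
theorem stub_ogpAsymptotics :
    ∃ k₀ : ℕ, ∀ k : ℕ, k₀ ≤ k → ∃ (β η θ : ℝ) (s F : ℕ), 0 < η ∧ η < β ∧ β < 5 * Real.log k / k ∧
      0 < θ ∧ θ < 1 ∧ 2 * θ ≤ β - η ∧ s + F ≤ k ∧
      0 ≤ (1 - (1 / 2 : ℝ) ^ k * (((1 : ℝ) + k * (1 - (2 * (1 - (β - η - 2 * θ) / (-Real.log θ)) ^ s + s * ((β - η - 2 * θ) / (-Real.log θ)) * (1 - (β - η - 2 * θ) / (-Real.log θ)) ^ (s - 1))) - θ * ((k : ℝ) * (k + 1) / 2)) - (k : ℝ) * (k + 1) / 2 * (1 / 2 : ℝ) ^ F)) ∧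
      ∀ A : ℕ, ∃ c : ℝ, 0 < c ∧ ∀ᶠ n : ℕ in atTop, ∀ K : ℕ, K ≤ n ^ A →
        ((K : ℝ) + 1) ^ (k + 1) * ((2 : ℝ) ^ n * (((n : ℝ) + 1) ^ (2 ^ k) * Real.exp (n * β)) ^ k) *
          (1 - (1 / 2 : ℝ) ^ k * (((1 : ℝ) + k * (1 - (2 * (1 - (β - η - 2 * θ) / (-Real.log θ)) ^ s + s * ((β - η - 2 * θ) / (-Real.log θ)) * (1 - (β - η - 2 * θ) / (-Real.log θ)) ^ (s - 1))) - θ * ((k : ℝ) * (k + 1) / 2)) - (k : ℝ) * (k + 1) / 2 * (1 / 2 : ℝ) ^ F)) ^ ⌊5 * 2 ^ k * Real.log k / k * n⌋₊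
          ≤ Real.exp (-(c * n)) :=
  Summit.PneNP.PneNP.Theorems.stub_ogpAsymptotics 

/-- **The ensemble OGP (Huang–Sellke 2025, Lemma 3.22) from the stubs** — VERBATIM the body of the
Literature def `HuangSellke2025KSatEnsembleOGP`: parameters and rate from `stub_ogpAsymptotics`;
eventually in `n` (`D n < n`, so `0 < ε ≤ 1`), the first moment `stub_ogpCore` (fed with
`stub_chainMassBasic`.1, `stub_chainMassUnion`, the per-tuple bound `ogp_tupleBound` and the count
`stub_bandCount`) is below the asymptotic bound. -/
theorem ensembleOGP_of_stubs :
    ∃ k₀ : ℕ, ∀ k : ℕ, k₀ ≤ k → ∃ β η : ℝ, 0 < η ∧ η < β ∧ β < 5 * Real.log k / k ∧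
      ∀ D : ℕ → ℕ, (fun n : ℕ => (D n : ℝ)) =o[atTop] (fun n : ℕ => (n : ℝ)) → (∀ n, 1 ≤ D n) →
        ∀ A : ℕ, ∃ c : ℝ, 0 < c ∧ ∀ᶠ n : ℕ in atTop, ∀ m : ℕ, m = ⌊5 * 2 ^ k * Real.log k / k * n⌋₊ →
          ∀ ε : ℝ, ε = Real.log (n / D n) / n → ∀ K : ℕ, K ≤ n ^ A →
          resampleChainMass ε K (fun y : ℕ → (Fin m × Fin k → Fin n × Bool) =>
              ∃ (t : ℕ → ℕ) (x : ℕ → Fin n → Bool), (∀ ℓ < k, t ℓ ≤ t (ℓ + 1)) ∧ t k ≤ K ∧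
                (∀ ℓ ≤ k, ∀ i : Fin m, ∃ j : Fin k, x ℓ (y (t ℓ) (i, j)).1 = (y (t ℓ) (i, j)).2) ∧
                ∀ ℓ, 1 ≤ ℓ → ℓ ≤ k → overlapCondEnt x ℓ ∈ Set.Icc (β - η) β)
            ≤ Real.exp (-(c * n)) := by
  obtain ⟨k₀, hk₀⟩ := stub_ogpAsymptotics
  refine ⟨max k₀ 1, fun k hk => ?_⟩
  obtain ⟨β, η, θ, s, F, hη, hηβ, hβ5, hθ, hθ1, hb, hsF, hbase, hasy⟩ :=
    hk₀ k (le_trans (le_max_left _ _) hk)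
  refine ⟨β, η, hη, hηβ, hβ5, fun D hD hD1 A => ?_⟩
  obtain ⟨c, hc, hev⟩ := hasy A
  refine ⟨c, hc, ?_⟩
  filter_upwards [hev, cas_eventually_lt D hD, eventually_ge_atTop 1] with n hevn hDn hn1
  intro m hm ε hε K hK
  obtain ⟨hεpos, hε1⟩ : 0 < ε ∧ ε ≤ 1 := by
    rw [hε]; exact cas_eps_bounds n (D n) hDn (hD1 n)
  have hk1 : 1 ≤ k := le_trans (le_max_right _ _) hk
  have hβ0 : 0 ≤ β := by linarith
  subst hm
  have hcore := stub_ogpCore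
    (fun ε h0 h1 K E E' hEE' =>
      (Summit.PneNP.PneNP.Theorems.stub_chainMassBasic ε h0 h1 K).1 E E' hEE')
    (fun ε h0 h1 K E => Summit.PneNP.PneNP.Theorems.stub_chainMassUnion ε h0 h1 K E)
    ogp_tupleBound stub_bandCount
    n ⌊5 * 2 ^ k * Real.log k / k * n⌋₊ k K s F hn1 hk1 hsF ε hεpos.le hε1 β η θ hβ0 hθ hθ1 hb
    hbase
  exact hcore.trans (hevn K hK)

end EnsembleOGP

/-- **The smaller named fact is now DERIVED** (cycle c2): Huang–Sellke 2025 Lemma 3.22 (ensemble OGP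
on the resampling chain), VERBATIM the body of the Literature def `HuangSellke2025KSatEnsembleOGP`,
from the stubs of section `EnsembleOGP` via `ensembleOGP_of_stubs`. -/
theorem stub_ensembleOGP :
    ∃ k₀ : ℕ, ∀ k : ℕ, k₀ ≤ k → ∃ β η : ℝ, 0 < η ∧ η < β ∧ β < 5 * Real.log k / k ∧
      ∀ D : ℕ → ℕ, (fun n : ℕ => (D n : ℝ)) =o[atTop] (fun n : ℕ => (n : ℝ)) → (∀ n, 1 ≤ D n) →
        ∀ A : ℕ, ∃ c : ℝ, 0 < c ∧ ∀ᶠ n : ℕ in atTop, ∀ m : ℕ, m = ⌊5 * 2 ^ k * Real.log k / k * n⌋₊ →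
          ∀ ε : ℝ, ε = Real.log (n / D n) / n → ∀ K : ℕ, K ≤ n ^ A →
          resampleChainMass ε K (fun y : ℕ → (Fin m × Fin k → Fin n × Bool) =>
              ∃ (t : ℕ → ℕ) (x : ℕ → Fin n → Bool), (∀ ℓ < k, t ℓ ≤ t (ℓ + 1)) ∧ t k ≤ K ∧
                (∀ ℓ ≤ k, ∀ i : Fin m, ∃ j : Fin k, x ℓ (y (t ℓ) (i, j)).1 = (y (t ℓ) (i, j)).2) ∧
                ∀ ℓ, 1 ≤ ℓ → ℓ ≤ k → overlapCondEnt x ℓ ∈ Set.Icc (β - η) β)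
            ≤ Real.exp (-(c * n)) :=
  ensembleOGP_of_stubs

/-- **The chaos lemma from the stubs** (wiring the landed generic pieces into the hypotheses of
`stub_chaosTupleBound` and `stub_chaosAssembly`). -/
theorem chaos_of :
    ∀ k : ℕ, 2 ≤ k → ∀ β : ℝ, β < 5 * Real.log k / k →
    ∃ b₁ : ℝ, 0 < b₁ ∧ ∀ b : ℝ, 0 < b → b ≤ b₁ → ∀ D : ℕ → ℕ,
      (fun n : ℕ => (D n : ℝ)) =o[atTop] (fun n : ℕ => (n : ℝ)) → (∀ n, 1 ≤ D n) →
      ∀ (a : (n m : ℕ) → (Fin m × Fin k → Fin n × Bool) → (Fin n → Bool)) (A : ℕ),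
      ∃ c : ℝ, 0 < c ∧ ∀ᶠ n : ℕ in atTop, ∀ m : ℕ, m = ⌊5 * 2 ^ k * Real.log k / k * n⌋₊ →
        ∀ ε : ℝ, ε = Real.log (n / D n) / n → ∀ K : ℕ, K ≤ n ^ A →
        resampleChainMass ε K (fun y : ℕ → (Fin m × Fin k → Fin n × Bool) =>
            ∃ (j : ℕ) (t : ℕ → ℕ) (x : Fin n → Bool), 1 ≤ j ∧ j ≤ k ∧
              (∀ ℓ < j, t ℓ ≤ t (ℓ + 1)) ∧ t j ≤ K ∧ (t (j - 1) : ℝ) + 1 / (b * k * ε) ≤ t j ∧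
              (∀ i : Fin m, ∃ j' : Fin k, x (y (t j) (i, j')).1 = (y (t j) (i, j')).2) ∧
              overlapCondEnt (fun ℓ => if ℓ < j then a n m (y (t ℓ)) else x) j ≤ β)
          ≤ Real.exp (-(c * n)) :=
  stub_chaosAssembly
    (fun ε h0 h1 K E E' hEE' => (Summit.PneNP.PneNP.Theorems.stub_chainMassBasic ε h0 h1 K).1 E E' hEE')
    (fun ε h0 h1 K E => stub_chainMassUnion ε h0 h1 K E)
    (fun n m k hn ε h0 h1 K j s Δ hj hsΔ τ hτ a β =>
      stub_chaosTupleBound (fun ε Δ w y' => stub_kernelPowPaths stub_kernelSemigroup ε Δ w y')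
        (fun ε h0 h1 K s Δ hsΔ A hA B q hq => stub_chainTwoBlock ε h0 h1 K s Δ hsΔ A hA B q hq)
        (fun ε h0 h1 K E => stub_chainMassUnion ε h0 h1 K E)
        stub_satProbBound stub_lowEntropyCount
        (fun ε h0 h1 K X _ E M hM => (stub_chainMassTotal ε h0 h1 K).2 X E M hM)
        n m k hn ε h0 h1 K j s Δ hj hsΔ τ hτ a β)
    stub_chaosAsymptotics

end Chaos

section HS25

/-! Vocabulary of this section (all in the tree, `Literature/Computability/Complexity/RandomKSatEnsembleOGP.lean`,
p115044): `resampleKernel ε y y'` (the `ε`-resampling kernel `∏_i ((1−ε)[y i = y' i] + ε/|Γ|)`,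
DEFINITIONALLY the explicit product used in the worker stubs), `resampleChainMass ε K E` (mass of an
event on `ℕ`-indexed paths under the chain of length `K` started uniformly), `overlapCondEnt`
(Bresler–Huang conditional overlap entropy, unordered form = DartGame `condEnt` of the
rung-`0`-normalised sequence), and the named fact `HuangSellke2025KSatObstructions`
(HS25 Lemmas 3.22–3.23). -/

/-- STUB — DERIVED (v10): the obstructions fact `HuangSellke2025KSatObstructions` (p115044) from the
smaller named fact `stub_ensembleOGP` (HS25 Lemma 3.22 alone) and the chaos theorem `chaos_of`
(HS25 Lemma 3.23, from the Chaos-section stubs) via the glue `stub_obstructionsOfOGP`. -/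
theorem stub_obstructions : HuangSellke2025KSatObstructions :=
  stub_obstructionsOfOGP stub_ensembleOGP chaos_of

/-- STUB — LANDED (p115950, `Theorems/OverlapGapAlgebraSearchHardWindowGrandCorrelation.lean`):
**grand correlation** (Huang–Sellke 2025, Lemma 3.15 / 2.7, deterministic abstract form). -/
theorem stub_grandCorrelation {S : Type*} [Fintype S] [DecidableEq S]
    (P : S → S → ℝ) (hP0 : ∀ y y', 0 ≤ P y y') (hPsymm : ∀ y y', P y y' = P y' y)
    (hPstoch : ∀ y, ∑ y', P y y' = 1)
    (hPpos : ∀ f : S → ℝ, (∑ y, f y) ^ 2 ≤ Fintype.card S * ∑ y, ∑ y', P y y' * (f y * f y'))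
    (good : S → Bool) (close : S → S → Bool) (hclose : ∀ y y', close y y' = close y' y)
    (p u : ℝ) (hp : 0 ≤ p) (hpS : p * Fintype.card S ≤ (univ.filter fun y => good y = true).card)
    (hu : ∑ y, ∑ y', P y y' * (if close y y' = true then (0 : ℝ) else 1) ≤ u * Fintype.card S)
    (K : ℕ) (hK : 1 ≤ K) :
    Fintype.card S * (max 0 (p ^ 2 - u)) ^ (2 * K) ≤
      ∑ y : Fin (K + 1) → S, (∏ t : Fin K, P (y t.castSucc) (y t.succ)) *
        (if (∀ t, good (y t) = true) ∧ (∀ t : Fin K, close (y t.castSucc) (y t.succ) = true)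
          then (1 : ℝ) else 0) :=
  Summit.PneNP.PneNP.Theorems.stub_grandCorrelation P hP0 hPsymm hPstoch hPpos good close hclose p u
    hp hpS hu K hK

/-- STUB — LANDED (p116116, `Theorems/OverlapGapAlgebraSearchHardWindowResampleKernelBasic.lean`):
the resampling kernel is nonnegative, symmetric and stochastic. -/
theorem stub_resampleKernelBasic {ι Γ : Type*} [Fintype ι] [DecidableEq ι] [Fintype Γ]
    [DecidableEq Γ] [Nonempty Γ] (ε : ℝ) (hε0 : 0 ≤ ε) (hε1 : ε ≤ 1) :
    (∀ y y' : ι → Γ,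
        0 ≤ ∏ i, ((1 - ε) * (if y i = y' i then (1 : ℝ) else 0) + ε / Fintype.card Γ)) ∧
    (∀ y y' : ι → Γ,
        (∏ i, ((1 - ε) * (if y i = y' i then (1 : ℝ) else 0) + ε / Fintype.card Γ)) =
          ∏ i, ((1 - ε) * (if y' i = y i then (1 : ℝ) else 0) + ε / Fintype.card Γ)) ∧
    (∀ y : ι → Γ,
        ∑ y' : ι → Γ, ∏ i, ((1 - ε) * (if y i = y' i then (1 : ℝ) else 0) + ε / Fintype.card Γ)
          = 1) :=
  Summit.PneNP.PneNP.Theorems.stub_resampleKernelBasic ε hε0 hε1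

/-- STUB — LANDED (p116552, `Theorems/OverlapGapAlgebraSearchHardWindowResamplePositivity.lean`):
one-step positivity of the resampling kernel. -/
theorem stub_resamplePositivity {ι Γ : Type*} [Fintype ι] [DecidableEq ι] [Fintype Γ]
    [DecidableEq Γ] [Nonempty Γ] (ε : ℝ) (hε0 : 0 ≤ ε) (hε1 : ε ≤ 1) (f : (ι → Γ) → ℝ) :
    (∑ y, f y) ^ 2 ≤ Fintype.card (ι → Γ) *
      ∑ y : ι → Γ, ∑ y' : ι → Γ,
        (∏ i, ((1 - ε) * (if y i = y' i then (1 : ℝ) else 0) + ε / Fintype.card Γ)) *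
          (f y * f y') :=
  Summit.PneNP.PneNP.Theorems.stub_resamplePositivity ε hε0 hε1 f

/-- STUB — LANDED (p117038, `Theorems/OverlapGapAlgebraSearchHardWindowResampleStability.lean`):
`L²`-stability of low coordinate-degree functions under resampling (HS25 Prop. 3.14). -/
theorem stub_resampleStability {ι Γ : Type*} [Fintype ι] [DecidableEq ι] [Fintype Γ]
    [DecidableEq Γ] [Nonempty Γ] (ε : ℝ) (hε0 : 0 ≤ ε) (hε1 : ε ≤ 1) {D : ℕ} {F : (ι → Γ) → ℝ}
    (hF : IsCoordDegreeLE D F) :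
    ∑ y : ι → Γ, ∑ y' : ι → Γ,
        (∏ i, ((1 - ε) * (if y i = y' i then (1 : ℝ) else 0) + ε / Fintype.card Γ)) *
          (F y - F y') ^ 2
      ≤ 2 * ε * (1 + ε * Fintype.card ι) * D * ∑ y, F y ^ 2 :=
  Summit.PneNP.PneNP.Theorems.stub_resampleStability ε hε0 hε1 hF

open Summit.PneNP.PneNP.Cruxes.NoStableSection.DartGame (condEnt withRung) in
/-- STUB — LANDED (p117201, `Theorems/OverlapGapAlgebraSearchHardWindowMoat.lean`): the moat /
ladder extraction along a chain (HS25 Lemmas 3.24–3.25 = BH Prop. 4.6 / Lemma 4.8). -/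
theorem stub_moat (n k W T : ℕ) (x : ℕ → (Fin n → Bool)) (β η : ℝ)
    (hW : 0 < W) (hη : 0 < η) (hηβ : η < β) (hT : k * W ≤ T)
    (hstab : ∀ t < T, (hammingDist (x t) (x (t + 1)) : ℝ) ≤ n / 2 ∧
      Real.binEntropy ((hammingDist (x t) (x (t + 1)) : ℝ) / n) ≤ η)
    (hchaos : ∀ (ℓ : ℕ) (ts : ℕ → ℕ) (t : ℕ), 1 ≤ ℓ → ℓ ≤ k → ts 0 = 0 →
      (∀ j, j + 1 < ℓ → ts j < ts (j + 1)) → (∀ j < ℓ, ts j + W ≤ t) → t ≤ T →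
      β < condEnt (fun j i => Bool.xor (withRung (fun j => x (ts j)) ℓ (x t) j i) (x (ts 0) i)) ℓ) :
    ∃ ts : ℕ → ℕ, ts 0 = 0 ∧ (∀ ℓ < k, ts ℓ < ts (ℓ + 1) ∧ ts (ℓ + 1) ≤ ts ℓ + W) ∧
      ∀ ℓ, 1 ≤ ℓ → ℓ ≤ k →
        condEnt (fun j i => Bool.xor (x (ts j) i) (x (ts 0) i)) ℓ ∈ Set.Icc (β - η) β :=
  Summit.PneNP.PneNP.Theorems.stub_moat n k W T x β η hW hη hηβ hT hstab hchaos

/-! ### Wave 2 (all LANDED: p117879, p118250, p118461, p118763) and the assembly (LANDED p119457) -/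

/-- STUB — LANDED (p117879) — **chain-mass bookkeeping**: `resampleChainMass` is monotone and subadditive in the
event (kernel weights are nonnegative for `0 ≤ ε ≤ 1`), and on an "all times good, all steps close"
event it is the grand-correlation path sum divided by `#(ι → Γ)`. -/
theorem stub_chainMassBasic {ι Γ : Type*} [Fintype ι] [DecidableEq ι] [Fintype Γ] [DecidableEq Γ]
    [Nonempty Γ] (ε : ℝ) (hε0 : 0 ≤ ε) (hε1 : ε ≤ 1) (K : ℕ) :
    (∀ E E' : (ℕ → ι → Γ) → Prop, (∀ z, E z → E' z) →
        resampleChainMass ε K E ≤ resampleChainMass ε K E') ∧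
    (∀ E E' : (ℕ → ι → Γ) → Prop,
        resampleChainMass ε K (fun z => E z ∨ E' z) ≤ resampleChainMass ε K E + resampleChainMass ε K E') ∧
    (∀ (good : (ι → Γ) → Bool) (close : (ι → Γ) → (ι → Γ) → Bool),
        resampleChainMass ε K (fun z => (∀ t ≤ K, good (z t) = true) ∧
            ∀ t < K, close (z t) (z (t + 1)) = true) * Fintype.card (ι → Γ) =
          ∑ y : Fin (K + 1) → ι → Γ, (∏ t : Fin K, resampleKernel ε (y t.castSucc) (y t.succ)) *
            (if (∀ t, good (y t) = true) ∧ (∀ t : Fin K, close (y t.castSucc) (y t.succ) = true)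
              then (1 : ℝ) else 0)) :=
  Summit.PneNP.PneNP.Theorems.stub_chainMassBasic ε hε0 hε1 K

/-- STUB — LANDED (p118250) — **instability bound** (Markov on top of the stability inequality `hStab`, which
is `stub_resampleStability` instantiated per output coordinate): for a vector-valued `F` on literal
arrays with energy `≤ C n #Φ`, the one-step mass of pairs whose outputs move by more than `θ n` in
squared norm is `≤ (2ε(1 + ε m k) D C / θ) · #Φ`. -/
theorem stub_instability (n m k : ℕ) (hn : 1 ≤ n) (ε θ C : ℝ) (hε0 : 0 ≤ ε) (hε1 : ε ≤ 1)
    (hθ : 0 < θ) (D : ℕ) (F : (Fin m → Fin k → Fin n × Bool) → Fin n → ℝ)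
    (hener : ∑ Φ : Fin m → Fin k → Fin n × Bool, ∑ v : Fin n, F Φ v ^ 2
      ≤ C * n * Fintype.card (Fin m → Fin k → Fin n × Bool))
    (hStab : ∀ v : Fin n,
      ∑ y : Fin m × Fin k → Fin n × Bool, ∑ y' : Fin m × Fin k → Fin n × Bool,
          resampleKernel ε y y' * (F (Function.curry y) v - F (Function.curry y') v) ^ 2
        ≤ 2 * ε * (1 + ε * Fintype.card (Fin m × Fin k)) * D *
            ∑ y : Fin m × Fin k → Fin n × Bool, F (Function.curry y) v ^ 2) :
    ∑ y : Fin m × Fin k → Fin n × Bool, ∑ y' : Fin m × Fin k → Fin n × Bool,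
        resampleKernel ε y y' *
          (if ∑ v, (F (Function.curry y) v - F (Function.curry y') v) ^ 2 ≤ θ * n then (0 : ℝ)
            else 1)
      ≤ 2 * ε * (1 + ε * (m * k)) * D * C / θ * Fintype.card (Fin m × Fin k → Fin n × Bool) :=
  Summit.PneNP.PneNP.Theorems.stub_instability n m k hn ε θ C hε0 hε1 hθ D F hener hStab

open Summit.PneNP.PneNP.Cruxes.NoStableSection.DartGame (condEnt withRung) in
/-- STUB — LANDED (p118461) — **moat transfer on a path of instances** (deterministic): along a path `z` of
literal arrays on which, up to time `T`, the saturated sign map of `F` solves every instance and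
consecutive real outputs move by `≤ θ n` in squared norm (`h₂(θ) ≤ η`, `θ ≤ 1/2`), if no CHAOS
structure with integer gap `W` exists (every satisfying candidate at a time `≥ W` after the previous
rung has conditional overlap entropy `> β` given the earlier outputs), then an OGP structure exists
(times `t 0 ≤ ⋯ ≤ t k ≤ T`, assignments solving the instances at those times, all conditional overlap
entropies in `[β − η, β]`) — via the moat `hMoat` (= `stub_moat`, landed p117201), `wld_hammingDist_le_sum_sq` and monotonicity of `h₂`. -/
theorem stub_moatTransfer
    (hMoat : ∀ (n k W T : ℕ) (x : ℕ → (Fin n → Bool)) (β η : ℝ), 0 < W → 0 < η → η < β →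
      k * W ≤ T →
      (∀ t < T, (hammingDist (x t) (x (t + 1)) : ℝ) ≤ n / 2 ∧
        Real.binEntropy ((hammingDist (x t) (x (t + 1)) : ℝ) / n) ≤ η) →
      (∀ (ℓ : ℕ) (ts : ℕ → ℕ) (t : ℕ), 1 ≤ ℓ → ℓ ≤ k → ts 0 = 0 →
        (∀ j, j + 1 < ℓ → ts j < ts (j + 1)) → (∀ j < ℓ, ts j + W ≤ t) → t ≤ T →
        β < condEnt (fun j i => Bool.xor (withRung (fun j => x (ts j)) ℓ (x t) j i) (x (ts 0) i))
          ℓ) →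
      ∃ ts : ℕ → ℕ, ts 0 = 0 ∧ (∀ ℓ < k, ts ℓ < ts (ℓ + 1) ∧ ts (ℓ + 1) ≤ ts ℓ + W) ∧
        ∀ ℓ, 1 ≤ ℓ → ℓ ≤ k →
          condEnt (fun j i => Bool.xor (x (ts j) i) (x (ts 0) i)) ℓ ∈ Set.Icc (β - η) β)
    (n m k W T : ℕ) (β η θ : ℝ) (hW : 0 < W) (hη : 0 < η) (hηβ : η < β)
    (hT : k * W ≤ T) (hθ : θ ≤ 1 / 2) (hθη : Real.binEntropy θ ≤ η) (hn : 1 ≤ n)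
    (F : (Fin m → Fin k → Fin n × Bool) → Fin n → ℝ) (z : ℕ → (Fin m × Fin k → Fin n × Bool))
    (hgood : ∀ t ≤ T, (∀ v, 1 ≤ |F (Function.curry (z t)) v|) ∧
      ∀ i : Fin m, ∃ j : Fin k,
        decide (0 ≤ F (Function.curry (z t)) (z t (i, j)).1) = (z t (i, j)).2)
    (hclose : ∀ t < T,
      ∑ v, (F (Function.curry (z t)) v - F (Function.curry (z (t + 1))) v) ^ 2 ≤ θ * n)
    (hnochaos : ∀ (j : ℕ) (t : ℕ → ℕ) (x : Fin n → Bool), 1 ≤ j → j ≤ k →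
      (∀ ℓ < j, t ℓ ≤ t (ℓ + 1)) → t j ≤ T → t (j - 1) + W ≤ t j →
      (∀ i : Fin m, ∃ j' : Fin k, x (z (t j) (i, j')).1 = (z (t j) (i, j')).2) →
      β < overlapCondEnt
        (fun ℓ => if ℓ < j then (fun v => decide (0 ≤ F (Function.curry (z (t ℓ))) v)) else x) j) :
    ∃ (t : ℕ → ℕ) (x : ℕ → Fin n → Bool), (∀ ℓ < k, t ℓ ≤ t (ℓ + 1)) ∧ t k ≤ T ∧
      (∀ ℓ ≤ k, ∀ i : Fin m, ∃ j : Fin k, x ℓ (z (t ℓ) (i, j)).1 = (z (t ℓ) (i, j)).2) ∧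
      ∀ ℓ, 1 ≤ ℓ → ℓ ≤ k → overlapCondEnt x ℓ ∈ Set.Icc (β - η) β :=
  Summit.PneNP.PneNP.Theorems.stub_moatTransfer hMoat n m k W T β η θ hW hη hηβ hT hθ hθη hn F z hgood hclose hnochaos

/-- STUB — LANDED (p118763) — **the parameter asymptotics of HS25 §3.3.2** (real analysis only): with
`ε_n = log(n / D n)/n` for `1 ≤ D = o(n)`, eventually `D n < n`, `ε_n > 0`, the instability level
`2ε_n(1 + ε_n ⌊αn⌋ k) D n · C/θ ≤ p²/2`, the chain length `T_n = k ⌈1/(b k ε_n)⌉ ≤ n²`, and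
`2 e^{−cn} < (p²/2)^{2 T_n}` (because `T_n = o(n)` as `log(n/D n) → ∞`). -/
theorem stub_hsAsymptotics (k : ℕ) (hk : 1 ≤ k) (α b c C θ p : ℝ) (hα : 0 < α) (hb : 0 < b)
    (hc : 0 < c) (hC : 0 < C) (hθ : 0 < θ) (hp : 0 < p) (D : ℕ → ℕ)
    (hD : (fun n : ℕ => (D n : ℝ)) =o[atTop] (fun n : ℕ => (n : ℝ))) (hD1 : ∀ n, 1 ≤ D n) :
    ∀ᶠ n : ℕ in atTop, (D n : ℝ) < n ∧ 0 < Real.log (n / D n) / n ∧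
      2 * (Real.log (n / D n) / n) * (1 + Real.log (n / D n) / n * (⌊α * n⌋₊ * k)) * D n * C / θ
        ≤ p ^ 2 / 2 ∧
      k * ⌈1 / (b * k * (Real.log (n / D n) / n))⌉₊ ≤ n ^ 2 ∧
      2 * Real.exp (-(c * n)) <
        (p ^ 2 / 2) ^ (2 * (k * ⌈1 / (b * k * (Real.log (n / D n) / n))⌉₊)) :=
  Summit.PneNP.PneNP.Theorems.stub_hsAsymptotics k hk α b c C θ p hα hb hc hC hθ hp D hD hD1

/-- STUB — LANDED (p119457, `Theorems/OverlapGapAlgebraSearchHardWindowHsAssembly.lean`) — **assembly of Huang–Sellke 2025 Cor. 3.21, deterministic saturated form**: the named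
fact `HuangSellke2025KSat` from the obstructions fact, using (by name, all in this section) grand
correlation, the kernel facts, positivity, stability via `stub_instability`, `stub_chainMassBasic`,
`stub_moatTransfer`, `stub_hsAsymptotics`. Parameters: `b = b₁`, `D' = max D 1`,
`a = saturated sign map of F`, `A = 2`; `ε = log(n/D')/n`, `W = ⌈1/(b k ε)⌉`, `T = k W`; `θ` with
`h₂(θ) ≤ η`, `θ ≤ 1/2`; good = "saturated and sign-solves", close = "`‖F y − F y'‖² ≤ θ n`",
`p = ε₀` (a frequently violated target bound), `u = 2ε(1+ε m k) D' C/θ ≤ p²/2`; then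
`(p²/2)^{2T} ≤ mass(all good & close) ≤ mass(OGP) + mass(CHAOS) ≤ 2e^{−cn}`, contradiction. -/
theorem stub_hsAssembly (hObs : HuangSellke2025KSatObstructions) : HuangSellke2025KSat :=
  Summit.PneNP.PneNP.Theorems.stub_hsAssembly hObs

end HS25


/-! ## The cone theorems under their Literature fact names (cycle c2) -/

/-- **Huang–Sellke 2025, Lemma 3.22** under its Literature fact name — LANDED in the tree as
`Summit.PneNP.PneNP.Theorems.huangSellke2025KSatEnsembleOGP_holds`
(`Theorems/OverlapGapAlgebraSearchHardWindowEnsembleOGPHolds.lean`, p124554, cycle c2; the gate recorded the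
discharge of the named fact). Here: the skeleton's own derivation `ensembleOGP_of_stubs`. -/
theorem huangSellke2025KSatEnsembleOGP_holds : HuangSellke2025KSatEnsembleOGP :=
  ensembleOGP_of_stubs

/-- **Huang–Sellke 2025, Lemmas 3.22–3.23** under the fact name `HuangSellke2025KSatObstructions` — LANDED
(`…EnsembleOGPHolds.lean`, p124554; named fact discharged). Here: OGP lemma + chaos theorem + glue. -/
theorem huangSellke2025KSatObstructions_holds : HuangSellke2025KSatObstructions :=
  stub_obstructionsOfOGP ensembleOGP_of_stubs chaos_of

/-- **Huang–Sellke 2025, Corollary 3.21 (strong low-degree hardness of random `k`-SAT)** under the fact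
name `HuangSellke2025KSat`, UNCONDITIONAL — LANDED (`…EnsembleOGPHolds.lean`, p124554; named fact
discharged). Here: the assembly over the obstructions theorem. -/
theorem huangSellke2025KSat_holds : HuangSellke2025KSat :=
  stub_hsAssembly huangSellke2025KSatObstructions_holds

/-! ## Weak rungs, now UNCONDITIONAL (`NoStableSection` is proved: `noStableSection_proof`, crux 2462 closed) -/

/-- STUB — LANDED (p120026) — **unconditional weak rungs**: poly-size `AC⁰` circuit families and
depth-`o(n / log n)` decision trees solve `F_k(2^j, ⌊α_k 2^j⌋)` on at most a `1 − c/log(2n)` fraction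
of the inputs, eventually — from `stub_weakClassRung` (p117380) fed with
`Summit.PneNP.PneNP.Theorems.noStableSection_proof` and the landed surrogate, Tal's tails at level
`polylog n = o(n/log n)` (the explicit level of `…ACTailBound.lean`), and `W^{≥ t+1}[decision tree of
depth ≤ t] = 0`. No named fact, no hypothesis. -/
theorem stub_weakRungsUnconditional :
    (∃ k₀ : ℕ, ∀ k : ℕ, k₀ ≤ k → ∃ c : ℝ, 0 < c ∧ ∀ d e : ℕ, ∀ᶠ n : ℕ in atTop, ∀ j m : ℕ,
      n = 2 ^ j → m = ⌊5 * 2 ^ k * Real.log k / k * n⌋₊ →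
      ∀ C : Fin (2 ^ j) → Circuit (Fin (m * k * (j + 1))),
        (∀ v, (C v).IsOver acBasis ∧ (C v).acDepth ≤ d ∧ (C v).size ≤ n ^ e) →
        ((univ.filter fun x : Fin (m * k * (j + 1)) → Bool => ∀ i : Fin m, ∃ j' : Fin k,
            (C (litArrayOfBits m k j x i j').1).eval x = (litArrayOfBits m k j x i j').2).card : ℝ)
          ≤ (1 - c / Real.log (2 * n)) * 2 ^ (m * k * (j + 1))) ∧
    (∃ k₀ : ℕ, ∀ k : ℕ, k₀ ≤ k → ∃ c : ℝ, 0 < c ∧ ∀ t : ℕ → ℕ,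
      (fun n : ℕ => (t n : ℝ)) =o[atTop] (fun n : ℕ => (n : ℝ) / Real.log n) →
      ∀ᶠ n : ℕ in atTop, ∀ j m : ℕ, n = 2 ^ j → m = ⌊5 * 2 ^ k * Real.log k / k * n⌋₊ →
      ∀ T : Fin (2 ^ j) → DecisionTree (m * k * (j + 1)), (∀ v, (T v).depth ≤ t n) →
        ((univ.filter fun x : Fin (m * k * (j + 1)) → Bool => ∀ i : Fin m, ∃ j' : Fin k,
            (T (litArrayOfBits m k j x i j').1).eval x = (litArrayOfBits m k j x i j').2).card : ℝ)
          ≤ (1 - c / Real.log (2 * n)) * 2 ^ (m * k * (j + 1))) :=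
  Summit.PneNP.PneNP.Theorems.stub_weakRungsUnconditional 

/-! ## Stubs of the composition -/

/-- STUB — DERIVED (v7): the named fact `HuangSellke2025KSat` (p102648) from the sub-skeleton of
section `HS25`; the ONLY sorry left in its cone is `stub_obstructions` (named fact, HS25 Lemmas 3.22–3.23):
the assembly `stub_hsAssembly` LANDED (p119457) over the landed generic and plumbing stubs. -/
theorem stub_strongLowDegreeHardness : HuangSellke2025KSat :=
  stub_hsAssembly stub_obstructions

/-- **Headline (registered stub `huangSellke2025KSat_of_ensembleOGP`, landing as
`Theorems/OverlapGapAlgebraSearchHardWindowStrongLDH.lean`, p121255)**: Huang–Sellke 2025 Cor. 3.21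
(the tree's named fact `HuangSellke2025KSat`) from the ensemble-OGP lemma ALONE — every other ingredient
of its printed proof (kernel semigroup/positivity/stability, grand correlation, moat, chaos L3.23,
assembly) is proved in this line. -/
theorem huangSellke2025KSat_of_ensembleOGP (h : HuangSellke2025KSatEnsembleOGP) : HuangSellke2025KSat :=
  stub_hsAssembly (stub_obstructionsOfOGP h chaos_of)

/-- STUB — OPEN, the KERNEL of Line A (conjecture-grade, the non-relativizing ingredient; lead's
own stub; modulo the named fact it is EQUIVALENT to the crux's hardness conjunct and, with the
proved `EvalRelationInP` and the route's `closes`, implies `PneNP`). -/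
theorem stub_polyTimeLowDegreeSimulable :
    ∀ k : ℕ, 3 ≤ k → ∀ f : List Bool → List Bool, IsPolyTime f → ∀ ε : ℝ, 0 < ε →
      (∃ᶠ n : ℕ in atTop, ∀ m : ℕ, m = ⌊5 * 2 ^ k * Real.log k / k * n⌋₊ →
        ε * Fintype.card (Fin m → Fin k → Fin n × Bool) ≤
          ((univ.filter fun Φ : Fin m → Fin k → Fin n × Bool => ∀ i, ∃ j,
              (f (encodingCNF.encode (List.ofFn fun a => List.ofFn fun b =>
                (((Φ a b).1 : ℕ), (Φ a b).2)))).getD (Φ i j).1 false = (Φ i j).2).card : ℝ)) →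
      ∃ C : ℝ, 0 < C ∧ ∃ D : ℕ → ℕ, (fun n : ℕ => (D n : ℝ)) =o[atTop] (fun n : ℕ => (n : ℝ)) ∧
        ∃ F : (n : ℕ) → (m : ℕ) → (Fin m → Fin k → Fin n × Bool) → Fin n → ℝ,
          (∀ (n m : ℕ) (v : Fin n), IsCoordDegreeLE (D n)
              (fun y : Fin m × Fin k → Fin n × Bool => F n m (Function.curry y) v)) ∧
          (∀ n m : ℕ, m = ⌊5 * 2 ^ k * Real.log k / k * n⌋₊ →
              ∑ Φ : Fin m → Fin k → Fin n × Bool, ∑ v : Fin n, F n m Φ v ^ 2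
                ≤ C * n * Fintype.card (Fin m → Fin k → Fin n × Bool)) ∧
          ∃ᶠ n : ℕ in atTop, ∀ m : ℕ, m = ⌊5 * 2 ^ k * Real.log k / k * n⌋₊ →
            ε / 2 * Fintype.card (Fin m → Fin k → Fin n × Bool) ≤
              ((univ.filter fun Φ : Fin m → Fin k → Fin n × Bool =>
                  (∀ v : Fin n, 1 ≤ |F n m Φ v|) ∧
                  ∀ i : Fin m, ∃ j : Fin k, decide (0 ≤ F n m Φ (Φ i j).1) = (Φ i j).2).card : ℝ) := by
  sorry

/-- STUB — CLOSED by the tree theorem `Summit.PneNP.PneNP.Theorems.positiveSatProbability_proof`,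
`Theorems/OverlapGapAlgebraPositiveSatProbability.lean`, item stmt-PneNP-2464. -/
theorem stub_positiveSatProbability : PositiveSatProbability :=
  Summit.PneNP.PneNP.Theorems.positiveSatProbability_proof

/-- Literal arrays over `n ≥ 1` variables form a nonempty type, so `#univ ≥ 1`. -/
theorem one_le_card_inst {m k n : ℕ} (hn : 1 ≤ n) :
    (1 : ℝ) ≤ Fintype.card (Fin m → Fin k → Fin n × Bool) := by
  have : Nonempty (Fin m → Fin k → Fin n × Bool) := ⟨fun _ _ => (⟨0, hn⟩, true)⟩
  exact_mod_cast Fintype.card_pos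

/-- STUB — LANDED (`Theorems/OverlapGapAlgebraSearchHardWindowComposition.lean`, p111218; proof repeated here so that this workfile does not wait for the farm build of that module):
named fact + kernel + positive satisfiability ⟹ the crux. Take `k ≥ max k₁ k₂ 3`,
`α := 5·2^k log k / k`; a poly-time `f` failing the hardness conjunct succeeds with count `≥ ε·#Φ`
frequently; the kernel gives a saturated low-degree `F` sign-solving `≥ ε/2·#Φ` frequently; the fact
gives `≤ ε/4·#Φ` eventually; `#Φ ≥ 1` for `n ≥ 1`. -/
theorem stub_lineAComposition (hLDH : HuangSellke2025KSat)
    (hKER : ∀ k : ℕ, 3 ≤ k → ∀ f : List Bool → List Bool, IsPolyTime f → ∀ ε : ℝ, 0 < ε →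
      (∃ᶠ n : ℕ in atTop, ∀ m : ℕ, m = ⌊5 * 2 ^ k * Real.log k / k * n⌋₊ →
        ε * Fintype.card (Fin m → Fin k → Fin n × Bool) ≤
          ((univ.filter fun Φ : Fin m → Fin k → Fin n × Bool => ∀ i, ∃ j,
              (f (encodingCNF.encode (List.ofFn fun a => List.ofFn fun b =>
                (((Φ a b).1 : ℕ), (Φ a b).2)))).getD (Φ i j).1 false = (Φ i j).2).card : ℝ)) →
      ∃ C : ℝ, 0 < C ∧ ∃ D : ℕ → ℕ, (fun n : ℕ => (D n : ℝ)) =o[atTop] (fun n : ℕ => (n : ℝ)) ∧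
        ∃ F : (n : ℕ) → (m : ℕ) → (Fin m → Fin k → Fin n × Bool) → Fin n → ℝ,
          (∀ (n m : ℕ) (v : Fin n), IsCoordDegreeLE (D n)
              (fun y : Fin m × Fin k → Fin n × Bool => F n m (Function.curry y) v)) ∧
          (∀ n m : ℕ, m = ⌊5 * 2 ^ k * Real.log k / k * n⌋₊ →
              ∑ Φ : Fin m → Fin k → Fin n × Bool, ∑ v : Fin n, F n m Φ v ^ 2
                ≤ C * n * Fintype.card (Fin m → Fin k → Fin n × Bool)) ∧
          ∃ᶠ n : ℕ in atTop, ∀ m : ℕ, m = ⌊5 * 2 ^ k * Real.log k / k * n⌋₊ →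
            ε / 2 * Fintype.card (Fin m → Fin k → Fin n × Bool) ≤
              ((univ.filter fun Φ : Fin m → Fin k → Fin n × Bool =>
                  (∀ v : Fin n, 1 ≤ |F n m Φ v|) ∧
                  ∀ i : Fin m, ∃ j : Fin k, decide (0 ≤ F n m Φ (Φ i j).1) = (Φ i j).2).card : ℝ))
    (hPOS : PositiveSatProbability) : SearchHardWindow := by
  obtain ⟨k₁, hLDH⟩ := hLDH
  obtain ⟨k₂, hSAT⟩ := hPOS
  unfold SearchHardWindow
  set k : ℕ := max (max k₁ k₂) 3 with hk
  have hk₁ : k₁ ≤ k := le_trans (le_max_left _ _) (le_max_left _ _)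
  have hk₂ : k₂ ≤ k := le_trans (le_max_right _ _) (le_max_left _ _)
  have hk₃ : 3 ≤ k := le_max_right _ _
  refine ⟨k, 5 * 2 ^ k * Real.log k / k, hSAT k hk₂, ?_⟩
  intro f hf ε hε
  by_contra H
  -- frequent success `> ε`, as a count inequality
  have hfreq : ∃ᶠ n : ℕ in atTop, ∀ m : ℕ, m = ⌊5 * 2 ^ k * Real.log k / k * n⌋₊ →
      ε * Fintype.card (Fin m → Fin k → Fin n × Bool) ≤
        ((univ.filter fun Φ : Fin m → Fin k → Fin n × Bool => ∀ i, ∃ j,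
            (f (encodingCNF.encode (List.ofFn fun a => List.ofFn fun b =>
              (((Φ a b).1 : ℕ), (Φ a b).2)))).getD (Φ i j).1 false = (Φ i j).2).card : ℝ) := by
    rw [Filter.not_eventually] at H
    refine H.mono fun n hn => ?_
    intro m hm
    rw [Classical.not_forall] at hn
    obtain ⟨m', hm'⟩ := hn
    rw [Classical.not_imp, not_le] at hm'
    obtain ⟨hm'eq, hlt⟩ := hm'
    subst hm; subst hm'eq
    set N := (Fintype.card (Fin ⌊5 * 2 ^ k * Real.log k / k * n⌋₊ → Fin k → Fin n × Bool) : ℝ)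
    have hNpos : 0 < N := by
      rcases lt_or_ge 0 N with h | h
      · exact h
      · have hN0 : N = 0 := le_antisymm h (Nat.cast_nonneg _)
        rw [hN0, div_zero] at hlt
        exact absurd hlt (not_lt.2 hε.le)
    exact le_of_lt ((lt_div_iff₀ hNpos).1 hlt)
  obtain ⟨C, hC, D, hD, F, hdeg, hener, hFfreq⟩ := hKER k hk₃ f hf ε hε hfreq
  have hev := hLDH k hk₁ C hC D hD F hdeg hener (ε / 4) (by positivity)
  obtain ⟨n, hn₁, hn₂, hn₃⟩ := (hFfreq.and_eventually (hev.and (eventually_ge_atTop 1))).exists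
  have h₁ := hn₁ _ rfl
  have h₂ := hn₂ _ rfl
  have hcard := one_le_card_inst (m := ⌊5 * 2 ^ k * Real.log k / k * n⌋₊) (k := k) hn₃
  have : ε / 2 * (Fintype.card (Fin ⌊5 * 2 ^ k * Real.log k / k * n⌋₊ → Fin k → Fin n × Bool) : ℝ)
      ≤ ε / 4 * Fintype.card (Fin ⌊5 * 2 ^ k * Real.log k / k * n⌋₊ → Fin k → Fin n × Bool) :=
    h₁.trans h₂
  nlinarith

/-- **Line A**: the crux from the stubs (sorries left in its cone: the named fact, the kernel). -/
theorem SearchHardWindow_of : SearchHardWindow :=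
  stub_lineAComposition stub_strongLowDegreeHardness stub_polyTimeLowDegreeSimulable
    stub_positiveSatProbability

/-! ## Rungs (card "First lemma"): AC⁰ and bounded-query solvers fail along `n = 2^j`

All LANDED and conditional on the named fact only:
`Theorems/OverlapGapAlgebraSearchHardWindow{TruncationSurrogate,ACTailBound,RungAssembly,Rungs}.lean`. -/

/-- STUB — LANDED (p103419): Walsh truncation surrogate. -/
theorem stub_truncationSurrogate {N n' : ℕ} (D : ℕ) (hD : 1 ≤ D)
    (g : Fin n' → (Fin N → Bool) → Bool) (τ : ℝ)
    (hτ : ∀ v, tailWeight (fun x => sgn (g v x)) D ≤ τ) :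
    ∃ c : Fin n' → Finset (Fin N) → ℝ,
      (∀ v S, D ≤ S.card → c v S = 0) ∧
      (∑ x : Fin N → Bool, ∑ v, (∑ S, c v S * walsh S x) ^ 2 ≤ 9 * n' * 2 ^ N) ∧
      ((univ.filter fun x : Fin N → Bool => ¬ ∀ v, (1 ≤ |∑ S, c v S * walsh S x| ∧
          decide (0 ≤ ∑ S, c v S * walsh S x) = g v x)).card : ℝ) ≤ 9 * n' * τ * 2 ^ N :=
  Summit.PneNP.PneNP.Theorems.stub_truncationSurrogate D hD g τ hτ

/-- STUB — LANDED (p103257): Tal 2017 tails of AC⁰ in asymptotic form. -/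
theorem stub_acTailBound (d c : ℕ) :
    ∃ D : ℕ → ℕ, (fun n : ℕ => (D n : ℝ)) =o[atTop] (fun n : ℕ => (n : ℝ)) ∧ (∀ n, 1 ≤ D n) ∧
      ∀ᶠ n : ℕ in atTop, ∀ (N : ℕ) (C : Circuit (Fin N)),
        C.IsOver acBasis → C.acDepth ≤ d → C.size ≤ n ^ c →
          tailWeight (fun x => sgn (C.eval x)) (D n) ≤ 1 / (n : ℝ) ^ 3 :=
  Summit.PneNP.PneNP.Theorems.stub_acTailBound d c

/-- STUB — LANDED (`Theorems/OverlapGapAlgebraSearchHardWindowRungAssembly.lean`, p109767, via the class rung `shw_classRung`). -/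
theorem stub_rungAssembly 
    (hLDH : HuangSellke2025KSat) (hT : ∀ {N n' : ℕ} (D : ℕ), 1 ≤ D → ∀ (g : Fin n' → (Fin N →
      Bool) → Bool) (τ : ℝ), (∀ v, tailWeight (fun x => sgn (g v x)) D ≤ τ) → ∃ c : Fin n' →
      Finset (Fin N) → ℝ, (∀ v S, D ≤ S.card → c v S = 0) ∧ (∑ x : Fin N → Bool, ∑ v, (∑ S, c v S
      * walsh S x) ^ 2 ≤ 9 * n' * 2 ^ N) ∧ ((univ.filter fun x : Fin N → Bool => ¬ ∀ v, (1 ≤ |∑ S,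
      c v S * walsh S x| ∧ decide (0 ≤ ∑ S, c v S * walsh S x) = g v x)).card : ℝ) ≤ 9 * n' * τ *
      2 ^ N) (hA : ∀ d c : ℕ, ∃ D : ℕ → ℕ, (fun n : ℕ => (D n : ℝ)) =o[atTop] (fun n : ℕ => (n :
      ℝ)) ∧ (∀ n, 1 ≤ D n) ∧ ∀ᶠ n : ℕ in atTop, ∀ (N : ℕ) (C : Circuit (Fin N)), C.IsOver acBasis
      → C.acDepth ≤ d → C.size ≤ n ^ c → tailWeight (fun x => sgn (C.eval x)) (D n) ≤ 1 / (n : ℝ)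
      ^ 3) : ∃ k₀ : ℕ, ∀ k : ℕ, k₀ ≤ k → ∀ d c : ℕ, ∀ ε : ℝ, 0 < ε → ∀ᶠ n : ℕ in atTop, ∀ j m : ℕ,
      n = 2 ^ j → m = ⌊5 * 2 ^ k * Real.log k / k * n⌋₊ → ∀ C : Fin (2 ^ j) → Circuit (Fin (m * k
      * (j + 1))), (∀ v, (C v).IsOver acBasis ∧ (C v).acDepth ≤ d ∧ (C v).size ≤ n ^ c) →
      ((univ.filter fun x : Fin (m * k * (j + 1)) → Bool => ∀ i : Fin m, ∃ j' : Fin k, (C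
      (litArrayOfBits m k j x i j').1).eval x = (litArrayOfBits m k j x i j').2).card : ℝ) ≤ ε * 2
      ^ (m * k * (j + 1)) :=
  Summit.PneNP.PneNP.Theorems.stub_rungAssembly hLDH hT hA

/-- STUB — PROVED (landing in `…Rungs.lean`, p110869): the AC⁰ rung, conditional on the named fact only. -/
theorem stub_acZeroRung 
    (hLDH : HuangSellke2025KSat) : ∃ k₀ : ℕ, ∀ k : ℕ, k₀ ≤ k → ∀ d c : ℕ, ∀ ε : ℝ, 0 < ε → ∀ᶠ n :
      ℕ in atTop, ∀ j m : ℕ, n = 2 ^ j → m = ⌊5 * 2 ^ k * Real.log k / k * n⌋₊ → ∀ C : Fin (2 ^ j)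
      → Circuit (Fin (m * k * (j + 1))), (∀ v, (C v).IsOver acBasis ∧ (C v).acDepth ≤ d ∧ (C
      v).size ≤ n ^ c) → ((univ.filter fun x : Fin (m * k * (j + 1)) → Bool => ∀ i : Fin m, ∃ j' :
      Fin k, (C (litArrayOfBits m k j x i j').1).eval x = (litArrayOfBits m k j x i j').2).card :
      ℝ) ≤ ε * 2 ^ (m * k * (j + 1)) :=
  Summit.PneNP.PneNP.Theorems.stub_rungAssembly hLDH
    (fun D hD g τ hτ => Summit.PneNP.PneNP.Theorems.stub_truncationSurrogate D hD g τ hτ)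
    Summit.PneNP.PneNP.Theorems.stub_acTailBound

/-- STUB — PROVED (landing in `…Rungs.lean`): the AC⁰ rung, `j`-form. -/
theorem stub_acZeroRungPow 
    (hLDH : HuangSellke2025KSat) : ∃ k₀ : ℕ, ∀ k : ℕ, k₀ ≤ k → ∀ d c : ℕ, ∀ ε : ℝ, 0 < ε → ∀ᶠ j :
      ℕ in atTop, ∀ m : ℕ, m = ⌊5 * 2 ^ k * Real.log k / k * (2 ^ j : ℕ)⌋₊ → ∀ C : Fin (2 ^ j) →
      Circuit (Fin (m * k * (j + 1))), (∀ v, (C v).IsOver acBasis ∧ (C v).acDepth ≤ d ∧ (C v).size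
      ≤ (2 ^ j) ^ c) → ((univ.filter fun x : Fin (m * k * (j + 1)) → Bool => ∀ i : Fin m, ∃ j' :
      Fin k, (C (litArrayOfBits m k j x i j').1).eval x = (litArrayOfBits m k j x i j').2).card :
      ℝ) ≤ ε * 2 ^ (m * k * (j + 1)) :=
by
  obtain ⟨k₀, h⟩ := stub_acZeroRung hLDH
  refine ⟨k₀, fun k hk d c ε hε => ?_⟩
  have hj :=
    (tendsto_pow_atTop_atTop_of_one_lt (one_lt_two : (1 : ℕ) < 2)).eventually (h k hk d c ε hε)
  filter_upwards [hj] with j hj m hm C hC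
  exact hj j m rfl hm C hC

/-- STUB — PROVED (landing in `…Rungs.lean`): the decision-tree (bounded-query) rung. -/
theorem stub_decisionTreeRung 
    (hLDH : HuangSellke2025KSat) : ∃ k₀ : ℕ, ∀ k : ℕ, k₀ ≤ k → ∀ t : ℕ → ℕ, (fun n : ℕ => (t n :
      ℝ)) =o[atTop] (fun n : ℕ => (n : ℝ)) → ∀ ε : ℝ, 0 < ε → ∀ᶠ n : ℕ in atTop, ∀ j m : ℕ, n = 2
      ^ j → m = ⌊5 * 2 ^ k * Real.log k / k * n⌋₊ → ∀ T : Fin (2 ^ j) → DecisionTree (m * k * (j +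
      1)), (∀ v, (T v).depth ≤ t n) → ((univ.filter fun x : Fin (m * k * (j + 1)) → Bool => ∀ i :
      Fin m, ∃ j' : Fin k, (T (litArrayOfBits m k j x i j').1).eval x = (litArrayOfBits m k j x i
      j').2).card : ℝ) ≤ ε * 2 ^ (m * k * (j + 1)) :=
by
  obtain ⟨k₀, hcls⟩ := Summit.PneNP.PneNP.Theorems.shw_classRung hLDH
    (fun D hD g τ hτ => Summit.PneNP.PneNP.Theorems.stub_truncationSurrogate D hD g τ hτ)
  refine ⟨k₀, fun k hk t ht ε hε => ?_⟩
  have hDo : (fun n : ℕ => ((t n + 1 : ℕ) : ℝ)) =o[atTop] (fun n : ℕ => (n : ℝ)) := by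
    have h1 : (fun _ : ℕ => ((1 : ℕ) : ℝ)) =o[atTop] (fun n : ℕ => (n : ℝ)) := by
      have := (isLittleO_const_id_atTop (1 : ℝ)).comp_tendsto tendsto_natCast_atTop_atTop
      simpa [Function.comp_def] using this
    simpa [Nat.cast_add] using ht.add h1
  have h := hcls k hk (fun n N g => ∃ T : DecisionTree N, T.depth ≤ t n ∧ ∀ x, g x = T.eval x)
    (fun n => t n + 1) hDo (fun n => Nat.succ_le_succ (Nat.zero_le _))
    (Eventually.of_forall fun n N g hg => by
      obtain ⟨T, hT, hg⟩ := hg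
      rw [tailWeight_decisionTree_eq_zero sgn T (fun x => by rw [hg x]) (Nat.lt_succ_of_le hT)]
      positivity) ε hε
  filter_upwards [h] with n hn j m hnj hm T hT
  exact hn j m hnj hm (fun v => (T v).eval) fun v => ⟨T v, hT v, fun _ => rfl⟩

/-- **The rungs from the stubs** (sorry left in the cone: the named fact only). -/
theorem acZeroRung_of : 
    ∃ k₀ : ℕ, ∀ k : ℕ, k₀ ≤ k → ∀ d c : ℕ, ∀ ε : ℝ, 0 < ε → ∀ᶠ n : ℕ in atTop, ∀ j m : ℕ, n = 2 ^
      j → m = ⌊5 * 2 ^ k * Real.log k / k * n⌋₊ → ∀ C : Fin (2 ^ j) → Circuit (Fin (m * k * (j +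
      1))), (∀ v, (C v).IsOver acBasis ∧ (C v).acDepth ≤ d ∧ (C v).size ≤ n ^ c) → ((univ.filter
      fun x : Fin (m * k * (j + 1)) → Bool => ∀ i : Fin m, ∃ j' : Fin k, (C (litArrayOfBits m k j
      x i j').1).eval x = (litArrayOfBits m k j x i j').2).card : ℝ) ≤ ε * 2 ^ (m * k * (j + 1)) :=
  stub_acZeroRung stub_strongLowDegreeHardness

/-! ## Weak rungs modulo `NoStableSection` only (v5)

The class rung in the WEAK form: the named fact `HuangSellke2025KSat` replaced by the tree theorem
`Summit.PneNP.PneNP.Theorems.weakLowDegreeHardness_of_noStableSection` (Bresler–Huang Thm. 2.6,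
proved modulo crux `NoStableSection` = stmt-PneNP-2462, whose line is closing). Conclusion: a class
with Fourier tails `≤ n⁻³` above a level `D = o(n / log n)` solves `F_k(2^j, ⌊α_k 2^j⌋)` for at most a
`1 − c/log(2n)` fraction of the inputs — i.e. never with probability `→ 1`; unconditional the moment
`NoStableSection` lands (AC⁰ and depth-`o(n/log n)` decision trees are instances, as in `…Rungs.lean`). -/

/-- STUB — LANDED (p117380, `Theorems/OverlapGapAlgebraSearchHardWindowWeakClassRung.lean`) — **weak class rung modulo `NoStableSection`**: the proof of
`Summit.PneNP.PneNP.Theorems.shw_classRung` with the weak low-degree hardness theorem in place of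
the named fact (`D = o(n/log n)`, energy constant `C = 9`, surrogate disagreement `9/n² ≤ c/(2 log 2n)`
eventually). -/
theorem stub_weakClassRung (hNo : NoStableSection)
    (hT : ∀ {N n' : ℕ} (D : ℕ), 1 ≤ D → ∀ (g : Fin n' → (Fin N → Bool) → Bool) (τ : ℝ),
      (∀ v, tailWeight (fun x => sgn (g v x)) D ≤ τ) →
      ∃ c : Fin n' → Finset (Fin N) → ℝ,
        (∀ v S, D ≤ S.card → c v S = 0) ∧
        (∑ x : Fin N → Bool, ∑ v, (∑ S, c v S * walsh S x) ^ 2 ≤ 9 * n' * 2 ^ N) ∧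
        ((univ.filter fun x : Fin N → Bool => ¬ ∀ v, (1 ≤ |∑ S, c v S * walsh S x| ∧
            decide (0 ≤ ∑ S, c v S * walsh S x) = g v x)).card : ℝ) ≤ 9 * n' * τ * 2 ^ N) :
    ∃ k₀ : ℕ, ∀ k : ℕ, k₀ ≤ k → ∃ c : ℝ, 0 < c ∧
      ∀ (𝒢 : (n N : ℕ) → ((Fin N → Bool) → Bool) → Prop) (D : ℕ → ℕ),
      (fun n : ℕ => (D n : ℝ)) =o[atTop] (fun n : ℕ => (n : ℝ) / Real.log n) → (∀ n, 1 ≤ D n) →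
      (∀ᶠ n : ℕ in atTop, ∀ (N : ℕ) (g : (Fin N → Bool) → Bool), 𝒢 n N g →
        tailWeight (fun x => sgn (g x)) (D n) ≤ 1 / (n : ℝ) ^ 3) →
      ∀ᶠ n : ℕ in atTop, ∀ j m : ℕ, n = 2 ^ j → m = ⌊5 * 2 ^ k * Real.log k / k * n⌋₊ →
        ∀ g : Fin (2 ^ j) → (Fin (m * k * (j + 1)) → Bool) → Bool,
          (∀ v, 𝒢 n (m * k * (j + 1)) (g v)) →
          ((univ.filter fun x : Fin (m * k * (j + 1)) → Bool =>
              ∀ i : Fin m, ∃ j' : Fin k, g (litArrayOfBits m k j x i j').1 x =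
                (litArrayOfBits m k j x i j').2).card : ℝ)
            ≤ (1 - c / Real.log (2 * n)) * 2 ^ (m * k * (j + 1)) :=
  Summit.PneNP.PneNP.Theorems.stub_weakClassRung hNo hT

end Summit.PneNP.PneNP.Cruxes.SearchHardWindow.LineA

end
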